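/-
Copyright (c) 2026. All rights reserved.
Released under Apache 2.0 license as described in the file LICENSE.
-/
import Mathlib.NumberTheory.Multiplicity
import Mathlib.NumberTheory.Padics.PadicVal.Basic
import Mathlib.RingTheory.ZMod.UnitsCyclic
import Mathlib.NumberTheory.LSeries.PrimesInAP
import Mathlib.LinearAlgebra.Matrix.GeneralLinearGroup.Card
import Mathlib.Data.Nat.Factorization.Basic
import Mathlib.FieldTheory.Finite.Basic
import Mathlib.LinearAlgebra.Matrix.ToLin
import Literature.NumberTheory.ComplexMultiplication.CMTypeRank
import Literature.GroupTheory.ArithmeticGroups.MinkowskiFiniteSubgroupOrder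
import HarnessLib

/-!
# Murty's lower bound for the rank of a simple CM type (Mai 1989, Proposition 2):
# `rank(K, S) ≥ (p − 1)² α / p` for every odd prime `p` with `p^α ∥ [K : ℚ]/2`

Companion of `NumberTheory/ComplexMultiplication/CMTypeRank` (abstract setting: a group `G` acting on the finite set
`E` of embeddings, the translates `translateInd Φ g = 𝟙_{g⁻¹Φ}`, the Kubota–Dodson rank `typeRank G Φ`) and of
`CMTypeRankLowerBounds` (Ribet's bounds `2 + log₂ n ≤ rank`, `p + 1 ≤ rank`; "Not here: … Mai's Prop. 1 / Murty's
Prop. 2" — Prop. 1 is `CMTypeRankRegularRepresentation`).  This file proves the second one.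

SOURCE.  L. Mai, *Lower bounds for the ranks of CM types*, J. Number Theory **32** (1989) 192–202 [Mai1989] (held
`paper:doi-10-1016-0022-314x-89-90025-5`), §2, p. 195–196:

> "The following result is due to Murty [5], giving another lower bound for the rank in terms of the prime divisors
> of `[K : ℚ]`.  PROPOSITION 2.  Let `K/ℚ` be a Galois extension, with `G = Gal(K/ℚ)`, `(K, S)` be a simple CM type.
> Then `rank(K, S) ≥ max_p {(p − 1)² α / p : p odd prime and p^α ∥ [K : ℚ]/2}`.
> Proof.  Consider `φ : X[K] → X[K']` … Let `Y = Im φ`; then `τ : G → GL(Y)` given by `τ(g)·φ[σ] = φ[gσ]` is an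
> injective group homomorphism (can be checked directly).  Since `Y` is a free `ℤ` module, `Y ≅ ℤʳ`, in which
> `r = rank Im φ`, thus `GL(Y) ≅ GL(ℤʳ) ≅ GL_r(ℤ)`.  If `q` is a sufficiently large prime, then `τ` induces an
> embedding `G ↪ GL_r(ℤ/qℤ)`.  In particular, `|G| ∣ |GL_r(ℤ/qℤ)| = q^{r(r−1)/2}(q^r − 1)(q^{r−1} − 1)⋯(q − 1)` (∗).
> Now let `p^α ∥ d`, `p` odd prime, and `q` be a primitive root mod `p^α`.  From (∗) `α ≤ ord_p(|GL_r(ℤ/qℤ)|) =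
> Σ_{i=1}^{r} ord_p(q^i − 1)` … By our choice of `q`, `ord_p(q^i − 1) = 0` if `(p−1) ∤ i`, `= j + 1` if
> `i = i₀ p^j (p − 1)`, `(i₀, p) = 1`.  Letting `σ = ⌊r/(p − 1)⌋`, we have `α ≤ Σ_{i=1}^{σ} ord_p(q^{i(p−1)} − 1) ≤
> σ + ord_p(σ!) ≤ σ p/(p − 1)`.  Therefore `r ≥ (p − 1)² α / p` for all odd prime `p` such that `p^α ∥ d`."

(restated by Gordon, *A survey of the Hodge conjecture for abelian varieties* §9.4.4 "Proposition ([B.72] Prop. 2)").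

## Statement proved (abstract form, integer form)

For a finite group `G` acting on a finite set `E`, a subset `Φ ⊆ E` whose family of translates `G` permutes
FAITHFULLY — hypothesis `hfaith : ∀ g, (∀ h, translateInd Φ (h * g) = translateInd Φ h) → g = 1`, which IS Mai's "`τ` is
an injective group homomorphism": it holds for `G` acting on itself when `Φ` has trivial stabiliser under right
translation (= `(K, S)` simple for `K` Galois, `sq_mul_padicValNat_card_le_mul_typeRank_of_forall_mul_mem_iff`), and for a
transitive FAITHFUL action when `Φ` is primitive in the tree's sense (`…_of_isPrimitive`; `E = Hom(K, ℂ)` under the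
Galois group of the Galois closure, `(K, S)` simple) — and every odd prime `p`:

> **`sq_mul_padicValNat_card_le_mul_typeRank`**: `(p − 1)² · v_p(|G|) ≤ p · rank(Φ)`.

(For `K` Galois, `|G| = [K : ℚ] = 2d` and `v_p(2d) = v_p(d) = α` for odd `p`: this is `rank ≥ (p − 1)² α / p`.)

## Proof (Mai's, with the reduction mod `q` done on the `0/1`-vectors directly)

* §1 ARITHMETIC (`sq_mul_padicValNat_prod_le`): for `q > 1`, `p ∤ q`, `p ∣ q^i − 1 ⟹ (p−1) ∣ i` and
  `v_p(q^{p−1} − 1) = 1`: `(p − 1)² · v_p(∏_{i<r}(q^r − q^i)) ≤ p · r` — `v_p = Σ_{i=1}^{r} v_p(q^i − 1)`, lifting the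
  exponent `v_p(q^{(p−1)j} − 1) = 1 + v_p(j)` (Mathlib `padicValNat.pow_sub_pow`), `= σ + v_p(σ!)`, Legendre
  `(p − 1) v_p(σ!) < σ` (Mathlib `sub_one_mul_padicValNat_factorial_lt_of_ne_zero`).
* §2 such primes `q` beyond any bound exist: `(ℤ/p²)ˣ` is cyclic (Mathlib `ZMod.isCyclic_units_of_prime_pow`), and
  Dirichlet's theorem (Mathlib `Nat.forall_exists_prime_gt_and_eq_mod`) gives primes `q ≡` a generator `(mod p²)`.
* §3 (`card_dvd_card_GL_span_translates`) for ANY finite field `F`: `G` acts on `F^E` by `f ↦ f ∘ g⁻¹`, permuting the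
  `0/1`-vectors `𝟙_{h⁻¹Φ}`, hence on their span `W_F`; the action is faithful (a `g` acting trivially fixes every
  translate — the `0/1`-vectors are equal in `F^E` iff the sets are equal), so `|G| ∣ |GL(W_F)| = |GL_n(F)|`,
  `n = dim W_F` (Lagrange; Mathlib `Matrix.card_GL_field`).  No "sufficiently large" is needed for faithfulness.
* §4 `dim_{𝔽_ℓ} W_{𝔽_ℓ} ≤ rank(Φ)` for every prime `ℓ` beyond the denominators expressing the translates in a `ℚ`-basis
  chosen among them (clear denominators, reduce mod `ℓ`).
* §5 assemble with `q` from §2 beyond the bound of §4: `(p−1)² v_p|G| ≤ (p−1)² v_p|GL_n(𝔽_q)| ≤ p n ≤ p · rank(Φ)`.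
* §6 (v2) the MINKOWSKI–SERRE form: Serre's exact count `v_p(∏_{i<r}(q^r − q^i)) = [r/(p−1)] + v_p([r/(p−1)]!)`
  (`padicValNat_prod_pow_sub_pow_eq`) `= Σ_k [r/(p^k(p−1))] = M(r, p)` (`div_add_padicValNat_factorial_eq_sum`), hence
  Minkowski's theorem for these groups: `v_p(|G|) ≤ M(rank Φ, p)` (`padicValNat_card_le_rank_div_add_padicValNat_factorial`,
  `…_of_isPrimitive`, `…_of_forall_mul_mem_iff`) — the `ℓ`-part of Dodson's "`p`-Sylow bound" Thm. 1.14, without `+ e_p`.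
* §7 (v3) DODSON'S REFINEMENT `e_p = 2` (Thm. 1.14: "we may split off a 1-dimensional trivial representation corresponding
  to `Φ + Φ̄` … the value of `e_p` for `p` odd follows from the independence of the norm `N_P(Φ) = Σ_{g∈P} Φᵍ` from
  `Φ + Φ̄`"): for a CM type (`IsCMTypeWith ρ Φ`) the `p`-Sylow subgroup `P` embeds in `GL(W_𝔽_q/⟨𝟙, n_P⟩)`
  (`card_subgroup_dvd_card_GL_sub_two`: an element trivial on the quotient is `1 + T`, `T² = 0`, and
  `(1 + T)^{|P|} = 1 + |P|T = 1` forces `T = 0`), whence **`v_p(|G|) ≤ M(rank Φ − 2, p)`**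
  (`IsCMTypeWith.padicValNat_card_le_rank_sub_two_div_add`, `…_of_isPrimitive`); evaluated for `p^e ∣ |G|`, `e < p`:
  `e(p − 1) + 2 ≤ rank Φ` (`IsCMTypeWith.mul_sub_one_add_two_le_typeRank_of_pow_dvd_card`, v3).
* §8 (v3) THROUGH THE TREE'S MINKOWSKI THEOREM.  The tree already holds Serre's Thm. 1 (i) for EVERY prime and every
  finite subgroup of `GL_n(ℚ)` (Schur's proof): `Literature.GroupTheory.ArithmeticGroups.factorization_card_le_minkowskiExponent`
  (`GroupTheory/ArithmeticGroups/MinkowskiFiniteSubgroupOrder.lean`, with `minkowskiExponent n ℓ = M(n, ℓ)`,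
  `minkowskiExponent_eq_add_padicValNat_factorial`) — noticed only after §6–§7 were written; §6 is thus a second,
  independent proof (Minkowski's original road, §1.3.3) of the special case needed here.  §8 takes the rational road:
  the faithful representation `G ↪ GL(W_ℚ) ≅ GL_r(ℚ)` (`exists_injective_monoidHom_GL_span_translates`, §3 over any
  field) gives `v_p(|G|) ≤ M(rank Φ, p)` for ALL primes (`padicValNat_card_le_minkowskiExponent_typeRank`); Dodson's
  splitting of `P`-fixed vectors over any field (`exists_injective_monoidHom_GL_sub_of_fixed`) gives **Thm. 1.14 for
  every prime, `v_p(|G|) ≤ M(rank Φ − e_p, p)`, `e_p = 2` (`p` odd), `e_2 = 1`**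
  (`IsCMTypeWith.padicValNat_card_le_minkowskiExponent_typeRank_sub`).

Theorems only (no definition, no named fact).  NOT here: the number-field dress (`cmTypeRank` of a `Motives.CMType`:
`Pohlmann1968/CMTypeRankMurtyBoundNumberField`, `CMTypeRankMurtyBoundReflex`); Mai's Prop. 3 (Fermat curves); the
comparison with Ribet's bound (Mai's Remark, p. 196); Dodson's exact values `R(p, n)` and the sharpness constructions
(Cor. 1.5–1.8, 1.13).

## References

* [Mai1989] L. Mai, *Lower bounds for the ranks of CM types*, J. Number Theory 32 (1989), §2 Prop. 2 (Murty) + proof.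
* [Gordon1999HodgeAVSurvey] B. B. Gordon, *A survey of the Hodge conjecture for abelian varieties*, §9.4.4.
* [Serre2007BoundsFiniteSubgroups] J.-P. Serre, *Bounds for the orders of the finite subgroups of G(k)* (2007),
  Lecture I §1: Thm. 1 (Minkowski 1887) and its proof §1.3.3 (held `paper:arxiv-1011.0346`).
* [Dodson1987] B. Dodson, *On the Mumford–Tate group of an abelian variety with complex multiplication*, J. Algebra
  111 (1987), Thm. 1.14 (pp. 55–56).
-/

set_option autoImplicit false

namespace Literature.NumberTheory.ComplexMultiplication

open Finset

/-! ### §1 Arithmetic: the `p`-part of `|GL_r(𝔽_q)|` for `q` of order `p − 1` mod `p`, `v_p(q^{p−1} − 1) = 1` -/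

section Arithmetic

variable {p : ℕ} [hp : Fact p.Prime]

/-- `Σ_{j<σ} v_p(j+1) = v_p(σ!)`. [folklore] -/
private theorem sum_range_padicValNat_succ_eq (σ : ℕ) :
    ∑ j ∈ range σ, padicValNat p (j + 1) = padicValNat p σ.factorial := by
  induction σ with
  | zero => simp
  | succ n ih =>
    rw [sum_range_succ, ih, Nat.factorial_succ, padicValNat.mul (Nat.succ_ne_zero n) (Nat.factorial_ne_zero n),
      add_comm]

/-- `v_p` of a product is the sum of the `v_p`. [folklore] -/
private theorem padicValNat_prod {ι : Type*} (s : Finset ι) (f : ι → ℕ) (hf : ∀ i ∈ s, f i ≠ 0) :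
    padicValNat p (∏ i ∈ s, f i) = ∑ i ∈ s, padicValNat p (f i) := by
  classical
  induction s using Finset.induction_on with
  | empty => simp
  | insert a s ha ih =>
    rw [prod_insert ha, sum_insert ha, padicValNat.mul (hf a (mem_insert_self a s))
      (prod_ne_zero_iff.2 fun i hi => hf i (mem_insert_of_mem hi)), ih fun i hi => hf i (mem_insert_of_mem hi)]

/-- The multiples of `d` in `1 … r` reindexed: `Σ_{i<r} f(i+1) = Σ_{j < r/d} f(d(j+1))` when `f` vanishes off the
multiples of `d`. [folklore] -/
private theorem sum_range_eq_sum_range_div {d r : ℕ} (hd : 0 < d) (f : ℕ → ℕ) (hf : ∀ m, ¬ d ∣ m → f m = 0) :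
    ∑ i ∈ range r, f (i + 1) = ∑ j ∈ range (r / d), f (d * (j + 1)) := by
  -- the injection `j ↦ d(j+1) − 1` from `range (r/d)` into `range r`
  have hinj : Set.InjOn (fun j => d * (j + 1) - 1) ↑(range (r / d)) := by
    intro a _ b _ hab
    have ha1 : 1 ≤ d * (a + 1) := Nat.one_le_iff_ne_zero.2 (by positivity)
    have hb1 : 1 ≤ d * (b + 1) := Nat.one_le_iff_ne_zero.2 (by positivity)
    have h1 : d * (a + 1) = d * (b + 1) := by
      simp only at hab
      omega
    have := Nat.eq_of_mul_eq_mul_left hd h1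
    omega
  have hrhs : ∑ j ∈ range (r / d), f (d * (j + 1)) =
      ∑ i ∈ (range (r / d)).image (fun j => d * (j + 1) - 1), f (i + 1) := by
    rw [sum_image hinj]
    refine sum_congr rfl fun j _ => ?_
    have h3 : 1 ≤ d * (j + 1) := Nat.one_le_iff_ne_zero.2 (by positivity)
    rw [Nat.sub_add_cancel h3]
  rw [hrhs]
  symm
  apply sum_subset_zero_on_sdiff
  · intro i hi
    rw [mem_image] at hi
    obtain ⟨j, hj, rfl⟩ := hi
    rw [mem_range] at hj ⊢
    have h2 : (j + 1) * d ≤ r := by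
      calc (j + 1) * d ≤ (r / d) * d := Nat.mul_le_mul_right d hj
        _ ≤ r := Nat.div_mul_le_self r d
    have h3 : 1 ≤ d * (j + 1) := Nat.one_le_iff_ne_zero.2 (by positivity)
    rw [mul_comm] at h2
    omega
  · intro i hi
    rw [mem_sdiff, mem_range, mem_image] at hi
    apply hf
    rintro ⟨m, hm⟩
    apply hi.2
    have hm0 : m ≠ 0 := by rintro rfl; simp at hm
    refine ⟨m - 1, ?_, ?_⟩
    · rw [mem_range]
      have h4 : m * d ≤ r := by rw [mul_comm]; omega
      have := (Nat.le_div_iff_mul_le hd).2 h4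
      omega
    · have : m - 1 + 1 = m := by omega
      rw [this]; omega
  · intro j _
    rfl

variable (hp2 : p ≠ 2) {q : ℕ} (hq : 1 < q) (hpq : ¬ p ∣ q)
  (hdiv : ∀ i, p ∣ q ^ i - 1 → (p - 1) ∣ i) (hv1 : padicValNat p (q ^ (p - 1) - 1) = 1)
include hp2 hq hpq hdiv hv1

/-- For `q` of order `p − 1` modulo `p` with `v_p(q^{p−1} − 1) = 1`:
`v_p(q^{(p−1)(j+1)} − 1) = 1 + v_p(j+1)` (lifting the exponent) and `v_p(q^i − 1) = 0` when `(p−1) ∤ i`. [folklore] -/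
private theorem padicValNat_pow_sub_one (i : ℕ) :
    padicValNat p (q ^ (i + 1) - 1) =
      if (p - 1) ∣ (i + 1) then 1 + padicValNat p ((i + 1) / (p - 1)) else 0 := by
  have hp3 : 3 ≤ p := by
    have := hp.out.two_le
    omega
  split_ifs with hd
  · obtain ⟨j, hj⟩ := hd
    have hj0 : j ≠ 0 := by rintro rfl; simp at hj
    rw [hj, Nat.mul_div_cancel_left j (by omega), pow_mul]
    have hodd : Odd p := hp.out.odd_of_ne_two hp2
    have h1 : 1 < q ^ (p - 1) := Nat.one_lt_pow (by omega) hq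
    have hx : ¬ p ∣ q ^ (p - 1) := fun h => hpq (hp.out.dvd_of_dvd_pow h)
    have hxy : p ∣ q ^ (p - 1) - 1 := by
      have h0 : q ^ (p - 1) - 1 ≠ 0 := by omega
      exact dvd_of_one_le_padicValNat (by rw [hv1])
    have := padicValNat.pow_sub_pow hodd h1 hxy hx hj0
    rw [one_pow] at this
    rw [this, hv1]
  · exact padicValNat.eq_zero_of_not_dvd fun h => hd (hdiv (i + 1) h)

/-- **Murty's count**: `(p − 1)² · v_p(∏_{i<r} (q^r − q^i)) ≤ p · r` — the `p`-part of `|GL_r(𝔽_q)|` for a prime power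
`q` of order `p − 1` mod `p` with `v_p(q^{p−1} − 1) = 1`: `v_p = σ + v_p(σ!)`, `σ = ⌊r/(p−1)⌋`, and Legendre's
`(p − 1) v_p(σ!) < σ`. [cite: Mai1989, §2 Prop. 2 (proof)] -/
theorem sq_mul_padicValNat_prod_le (r : ℕ) :
    (p - 1) ^ 2 * padicValNat p (∏ i : Fin r, (q ^ r - q ^ (i : ℕ))) ≤ p * r := by
  have hp3 : 3 ≤ p := by
    have := hp.out.two_le
    omega
  -- `∏_{i<r} (q^r − q^i) = ∏_{i<r} q^i (q^{r-i} − 1)`, so `v_p = Σ_{i<r} v_p(q^{r−i} − 1) = Σ_{k<r} v_p(q^{k+1} − 1)`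
  have hfac : ∀ i : Fin r, q ^ r - q ^ (i : ℕ) = q ^ (i : ℕ) * (q ^ (r - i) - 1) := by
    intro i
    rw [Nat.mul_sub_one, ← pow_add, Nat.add_sub_cancel' (le_of_lt i.2)]
  have hne : ∀ i : Fin r, q ^ r - q ^ (i : ℕ) ≠ 0 := by
    intro i
    have : q ^ (i : ℕ) < q ^ r := Nat.pow_lt_pow_right hq i.2
    omega
  have hval : padicValNat p (∏ i : Fin r, (q ^ r - q ^ (i : ℕ))) = ∑ k ∈ range r, padicValNat p (q ^ (k + 1) - 1) := by
    rw [padicValNat_prod _ _ fun i _ => hne i]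
    have h1 : ∀ i : Fin r, padicValNat p (q ^ r - q ^ (i : ℕ)) = padicValNat p (q ^ (r - i) - 1) := by
      intro i
      have hq0 : q ^ (i : ℕ) ≠ 0 := pow_ne_zero _ (by omega)
      have hq1 : q ^ (r - i) - 1 ≠ 0 := by
        have : 1 < q ^ (r - (i : ℕ)) := Nat.one_lt_pow (by have := i.2; omega) hq
        omega
      rw [hfac, padicValNat.mul hq0 hq1, padicValNat.pow, padicValNat.eq_zero_of_not_dvd hpq, mul_zero, zero_add]
    simp_rw [h1]
    rw [Fin.sum_univ_eq_sum_range (fun i => padicValNat p (q ^ (r - i) - 1)) r, ← sum_range_reflect]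
    refine sum_congr rfl fun k hk => ?_
    rw [mem_range] at hk
    have hk' : r - (r - 1 - k) = k + 1 := by omega
    rw [hk']
  rw [hval, sum_range_eq_sum_range_div (d := p - 1) (by omega) (fun m => padicValNat p (q ^ m - 1))
    (fun m hm => padicValNat.eq_zero_of_not_dvd fun h => hm (hdiv m h))]
  -- each term is `1 + v_p(j+1)`
  have hterm : ∀ j, padicValNat p (q ^ ((p - 1) * (j + 1)) - 1) = 1 + padicValNat p (j + 1) := by
    intro j
    have h := padicValNat_pow_sub_one hp2 hq hpq hdiv hv1 ((p - 1) * (j + 1) - 1)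
    have h3 : 1 ≤ (p - 1) * (j + 1) := Nat.one_le_iff_ne_zero.2 (Nat.mul_ne_zero (by omega) (by omega))
    rw [Nat.sub_add_cancel h3, if_pos (dvd_mul_right _ _), Nat.mul_div_cancel_left _ (by omega)] at h
    exact h
  simp_rw [hterm]
  rw [sum_add_distrib, sum_const, card_range, smul_eq_mul, mul_one, sum_range_padicValNat_succ_eq]
  set σ := r / (p - 1) with hσ
  -- Legendre: `(p − 1) v_p(σ!) < σ` (or both `0`)
  have hleg : (p - 1) * padicValNat p σ.factorial ≤ σ := by
    rcases eq_or_ne σ 0 with h0 | h0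
    · rw [h0]; simp
    · exact (sub_one_mul_padicValNat_factorial_lt_of_ne_zero p h0).le
  have hσr : (p - 1) * σ ≤ r := by rw [hσ, mul_comm]; exact Nat.div_mul_le_self r (p - 1)
  calc (p - 1) ^ 2 * (σ + padicValNat p σ.factorial)
      = (p - 1) * ((p - 1) * σ + (p - 1) * padicValNat p σ.factorial) := by ring
    _ ≤ (p - 1) * ((p - 1) * σ + σ) := Nat.mul_le_mul_left _ (by omega)
    _ = p * ((p - 1) * σ) := by
        have : p - 1 + 1 = p := by omega
        nlinarith [this]
    _ ≤ p * r := Nat.mul_le_mul_left _ hσr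

end Arithmetic


/-! ### §2 Primes which are primitive roots modulo `p²` -/


section PrimitiveRootPrime

variable {p : ℕ} [hp : Fact p.Prime]

/-- **A prime `q ≡` primitive root `(mod p²)` beyond any bound** (Dirichlet + cyclicity of `(ℤ/p²)ˣ`, `p` odd):
`q > N` prime with `p ∤ q`, `p ∣ q^i − 1 ⟹ (p − 1) ∣ i` (the order of `q` mod `p` is `p − 1`) and
`v_p(q^{p−1} − 1) = 1` (the order of `q` mod `p²` is `p(p − 1)`). [folklore] -/
private theorem exists_prime_gt_primitiveRoot (hp2 : p ≠ 2) (N : ℕ) :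
    ∃ q, N < q ∧ q.Prime ∧ ¬ p ∣ q ∧ (∀ i, p ∣ q ^ i - 1 → (p - 1) ∣ i) ∧
      padicValNat p (q ^ (p - 1) - 1) = 1 := by
  have hpp := hp.out
  have hp3 : 3 ≤ p := by have := hpp.two_le; omega
  haveI : NeZero (p ^ 2) := ⟨pow_ne_zero _ hpp.ne_zero⟩
  haveI : NeZero p := ⟨hpp.ne_zero⟩
  -- a generator of `(ℤ/p²)ˣ`
  haveI hcyc : IsCyclic (ZMod (p ^ 2))ˣ := ZMod.isCyclic_units_of_prime_pow p hpp hp2 2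
  obtain ⟨g, hg⟩ := IsCyclic.exists_generator (α := (ZMod (p ^ 2))ˣ)
  have hordg : orderOf g = p * (p - 1) := by
    rw [orderOf_eq_card_of_forall_mem_zpowers hg, Nat.card_eq_fintype_card, ZMod.card_units_eq_totient,
      Nat.totient_prime_pow hpp (by norm_num)]
    simp
  -- Dirichlet: a prime `q > max N p²` with `q ≡ g (mod p²)`
  obtain ⟨q, hqN, hqprime, hqg⟩ := Nat.forall_exists_prime_gt_and_eq_mod (q := p ^ 2) (a := (g : ZMod (p ^ 2)))
    g.isUnit N
  have hq2 : 2 ≤ q := hqprime.two_le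
  -- `p ∤ q`
  have hpq : ¬ p ∣ q := by
    intro h
    have hu : IsUnit (q : ZMod (p ^ 2)) := by rw [hqg]; exact g.isUnit
    rw [ZMod.isUnit_iff_coprime] at hu
    have : p ∣ Nat.gcd q (p ^ 2) := Nat.dvd_gcd h (dvd_pow_self p two_ne_zero)
    rw [hu] at this
    exact hpp.one_lt.ne' (Nat.dvd_one.1 this)
  -- reduction mod `p`: the image of `g` has order `p − 1`
  have hdvd : p ∣ p ^ 2 := dvd_pow_self p two_ne_zero
  set gbar : (ZMod p)ˣ := ZMod.unitsMap hdvd g with hgbar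
  have hgen : ∀ x : (ZMod p)ˣ, x ∈ Subgroup.zpowers gbar := by
    intro x
    obtain ⟨y, rfl⟩ := ZMod.unitsMap_surjective hdvd x
    obtain ⟨k, rfl⟩ := Subgroup.mem_zpowers_iff.1 (hg y)
    exact ⟨k, by rw [hgbar, map_zpow]⟩
  have hordgbar : orderOf gbar = p - 1 := by
    rw [orderOf_eq_card_of_forall_mem_zpowers hgen, Nat.card_eq_fintype_card, ZMod.card_units_eq_totient,
      Nat.totient_prime hpp]
  have hqbar : ((q : ZMod p)) = (gbar : ZMod p) := by
    rw [hgbar, ZMod.unitsMap_val, ← hqg, ZMod.cast_natCast hdvd]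
  refine ⟨q, hqN, hqprime, hpq, fun i hi => ?_, ?_⟩
  · -- `q^i ≡ 1 (mod p)` ⟹ `gbar^i = 1` ⟹ `p − 1 ∣ i`
    have h1 : ((q : ZMod p)) ^ i = 1 := by
      have hle : 1 ≤ q ^ i := Nat.one_le_pow _ _ (by omega)
      have h0 : ((q ^ i - 1 : ℕ) : ZMod p) = 0 := (ZMod.natCast_eq_zero_iff _ _).2 hi
      rw [Nat.cast_sub hle, Nat.cast_pow, Nat.cast_one, sub_eq_zero] at h0
      exact h0
    rw [hqbar, ← Units.val_pow_eq_pow_val, Units.val_eq_one] at h1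
    rw [← hordgbar]
    exact orderOf_dvd_of_pow_eq_one h1
  · -- `v_p(q^{p−1} − 1) = 1`
    have hne : q ^ (p - 1) - 1 ≠ 0 := by
      have : 1 < q ^ (p - 1) := Nat.one_lt_pow (by omega) (by omega)
      omega
    apply le_antisymm
    · -- not divisible by `p²`: else `g^{p−1} = 1`
      by_contra hlt
      push Not at hlt
      have h2 : p ^ 2 ∣ q ^ (p - 1) - 1 := (padicValNat_dvd_iff_le hne).2 hlt
      have h3 : ((q : ZMod (p ^ 2))) ^ (p - 1) = 1 := by
        have hle : 1 ≤ q ^ (p - 1) := Nat.one_le_pow _ _ (by omega)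
        have h0 : ((q ^ (p - 1) - 1 : ℕ) : ZMod (p ^ 2)) = 0 := (ZMod.natCast_eq_zero_iff _ _).2 h2
        rw [Nat.cast_sub hle, Nat.cast_pow, Nat.cast_one, sub_eq_zero] at h0
        exact h0
      rw [hqg, ← Units.val_pow_eq_pow_val, Units.val_eq_one] at h3
      have h4 := orderOf_dvd_of_pow_eq_one h3
      rw [hordg] at h4
      have h5 := Nat.le_of_dvd (by omega) h4
      have h6 : p * (p - 1) ≥ 3 * (p - 1) := Nat.mul_le_mul_right _ hp3
      omega
    · -- divisible by `p`: Fermat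
      refine (padicValNat_dvd_iff_le hne).1 ?_
      rw [pow_one, ← ZMod.natCast_eq_zero_iff]
      have hle : 1 ≤ q ^ (p - 1) := Nat.one_lt_pow (by omega) (by omega) |>.le
      rw [Nat.cast_sub hle, Nat.cast_pow, Nat.cast_one, sub_eq_zero]
      apply ZMod.pow_card_sub_one_eq_one
      rw [Ne, ZMod.natCast_eq_zero_iff]
      exact hpq

end PrimitiveRootPrime

/-! ### §3–§4 The translates modulo a prime: `G ↪ GL(W_F)`; `dim W_{𝔽_ℓ} ≤ rank(Φ)` -/

section ModQ

variable {G : Type*} [Group G] [Fintype G] {E : Type*} [Fintype E] [MulAction G E]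

omit [Fintype G] in
open scoped Classical in
/-- **`G` embeds in `GL(W_F)`** for `W_F` the `F`-span of the `0/1`-vectors of the translates of `Φ` (`F` any finite
field): `g` acts by `f ↦ f ∘ g⁻¹`, permuting the translates, and acts trivially only if it fixes every translate —
excluded by the faithfulness hypothesis (Mai: "`τ : G → GL(Y)` … is an injective group homomorphism").  Hence
`|G|` divides `|GL_n(F)|`, `n = dim_F W_F`. [cite: Mai1989, §2 Prop. 2 (proof)] -/
theorem card_dvd_card_GL_span_translates (F : Type*) [Field F] [Fintype F] (Φ : Set E)
    (hfaith : ∀ g : G, (∀ h : G, translateInd Φ (h * g) = translateInd Φ h) → g = 1) :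
    Nat.card G ∣ Nat.card (GL (Fin (Module.finrank F (Submodule.span F
      (Set.range fun g : G => fun x : E => if g • x ∈ Φ then (1 : F) else 0)))) F) := by
  set u : G → E → F := fun g x => if g • x ∈ Φ then (1 : F) else 0 with hu
  set W : Submodule F (E → F) := Submodule.span F (Set.range u) with hW
  -- the linear maps `M g : f ↦ f ∘ (g⁻¹ • ·)` permute the translates: `M g (u h) = u (h g⁻¹)`
  have hM : ∀ g h : G, LinearMap.funLeft F F (fun x : E => g⁻¹ • x) (u h) = u (h * g⁻¹) := by
    intro g h
    funext x
    simp only [LinearMap.funLeft_apply, hu, mul_smul]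
  have hstab : ∀ g : G, ∀ v ∈ W, LinearMap.funLeft F F (fun x : E => g⁻¹ • x) v ∈ W := by
    intro g v hv
    have hle : W.map (LinearMap.funLeft F F (fun x : E => g⁻¹ • x)) ≤ W := by
      rw [hW, Submodule.map_span_le]
      rintro _ ⟨h, rfl⟩
      rw [hM]
      exact Submodule.subset_span ⟨h * g⁻¹, rfl⟩
    exact hle (Submodule.mem_map_of_mem hv)
  let ρ : G →* Module.End F W :=
    { toFun := fun g => (LinearMap.funLeft F F (fun x : E => g⁻¹ • x)).restrict (hstab g)
      map_one' := by
        apply LinearMap.ext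
        intro v
        apply Subtype.ext
        funext x
        simp [LinearMap.restrict_apply]
      map_mul' := fun g g' => by
        apply LinearMap.ext
        intro v
        apply Subtype.ext
        funext x
        simp [LinearMap.restrict_apply, mul_smul] }
  have hρ : ∀ (g : G) (v : W) (x : E), ((ρ g v : W) : E → F) x = (v : E → F) (g⁻¹ • x) := fun g v x => rfl
  -- faithfulness
  have hinj : Function.Injective ρ.toHomUnits := by
    rw [injective_iff_map_eq_one]
    intro g hg
    have hg' : ρ g = 1 := by
      have := congrArg (fun z : (Module.End F W)ˣ => (z : Module.End F W)) hg
      simpa using this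
    have hfix : ∀ h : G, translateInd Φ (h * g⁻¹) = translateInd Φ h := by
      intro h
      have hmem : u h ∈ W := Submodule.subset_span ⟨h, rfl⟩
      have h1 : ((ρ g ⟨u h, hmem⟩ : W) : E → F) = u h := by rw [hg']; rfl
      funext x
      have h2 := congrFun h1 x
      rw [hρ] at h2
      change u h (g⁻¹ • x) = u h x at h2
      simp only [hu, ← mul_smul] at h2
      by_cases hx : (h * g⁻¹) • x ∈ Φ
      · rw [translateInd_of_mem hx]
        rw [if_pos hx] at h2
        by_cases hx' : h • x ∈ Φ
        · rw [translateInd_of_mem hx']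
        · rw [if_neg hx'] at h2; exact absurd h2 one_ne_zero
      · rw [translateInd_of_not_mem hx]
        rw [if_neg hx] at h2
        by_cases hx' : h • x ∈ Φ
        · rw [if_pos hx'] at h2; exact absurd h2.symm one_ne_zero
        · rw [translateInd_of_not_mem hx']
    have := hfaith g⁻¹ hfix
    exact inv_eq_one.1 this
  -- to matrices through a basis of `W`
  let b := Module.finBasis F W
  let e := LinearMap.toMatrixAlgEquiv b
  let Ψ : G →* GL (Fin (Module.finrank F W)) F :=
    (Units.mapEquiv e.toMulEquiv).toMonoidHom.comp ρ.toHomUnits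
  have hΨ : Function.Injective Ψ := (Units.mapEquiv e.toMulEquiv).injective.comp hinj
  exact Subgroup.card_dvd_of_injective Ψ hΨ

end ModQ

section Reduction

variable {G : Type*} [Group G] [Fintype G] {E : Type*} [Fintype E] [MulAction G E]

open scoped Classical in
/-- **The rank does not go up modulo large primes**: beyond the denominators expressing every translate of `Φ` in a
`ℚ`-basis chosen among the translates, the `𝔽_ℓ`-span of the `0/1`-vectors of the translates has dimension at most
`rank(Φ)`. [folklore] -/
private theorem exists_forall_finrank_span_translates_le_typeRank (Φ : Set E) :
    ∃ N : ℕ, ∀ ℓ : ℕ, N < ℓ → ℓ.Prime →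
      Module.finrank (ZMod ℓ) (Submodule.span (ZMod ℓ)
        (Set.range fun g : G => fun x : E => if g • x ∈ Φ then (1 : ZMod ℓ) else 0)) ≤ typeRank G Φ := by
  obtain ⟨b, hb_sub, hb_span, hb_li⟩ := exists_linearIndependent ℚ (Set.range fun g : G => translateInd Φ g)
  have hbfin : b.Finite := (Set.finite_range _).subset hb_sub
  set bF : Finset (E → ℚ) := hbfin.toFinset with hbF
  have hbF_coe : (bF : Set (E → ℚ)) = b := hbfin.coe_toFinset
  -- `rank = |bF|`
  have hrank : typeRank G Φ = bF.card := by
    haveI : Fintype b := hbfin.fintype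
    rw [typeRank, ← hb_span]
    have := finrank_span_eq_card (R := ℚ) (b := ((↑) : b → E → ℚ)) hb_li
    rw [Subtype.range_coe_subtype, Set.setOf_mem_eq] at this
    rw [this, ← hbfin.card_toFinset]
  -- each basis vector is a translate
  have hv : ∀ v ∈ bF, ∃ g : G, translateInd Φ g = v := by
    intro v hv
    rw [Set.Finite.mem_toFinset] at hv
    obtain ⟨g, hg⟩ := hb_sub hv
    exact ⟨g, hg⟩
  choose! gv hgv using hv
  -- every translate is a `ℚ`-combination of `bF`
  have hcoef : ∀ h : G, ∃ c : (E → ℚ) → ℚ, ∑ v ∈ bF, c v • v = translateInd Φ h := by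
    intro h
    have hmem : translateInd Φ h ∈ Submodule.span ℚ (bF : Set (E → ℚ)) := by
      rw [hbF_coe, hb_span]
      exact Submodule.subset_span ⟨h, rfl⟩
    obtain ⟨c, -, hc⟩ := Submodule.mem_span_finset.1 hmem
    exact ⟨c, hc⟩
  choose c hc using hcoef
  refine ⟨∏ h, ∏ v ∈ bF, (c h v).den, fun ℓ hℓN hℓ => ?_⟩
  haveI : Fact ℓ.Prime := ⟨hℓ⟩
  -- `ℓ` divides no denominator
  have hden : ∀ h : G, ∀ v ∈ bF, ¬ ℓ ∣ (c h v).den := by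
    intro h v hv hdvd
    have h1 : (c h v).den ∣ ∏ h, ∏ v ∈ bF, (c h v).den :=
      (Finset.dvd_prod_of_mem (fun v => (c h v).den) hv).trans
        (Finset.dvd_prod_of_mem (fun h => ∏ v ∈ bF, (c h v).den) (Finset.mem_univ h))
    have h2 : (c h v).den ≤ ∏ h, ∏ v ∈ bF, (c h v).den :=
      Nat.le_of_dvd (Finset.prod_pos fun h _ => Finset.prod_pos fun v _ => (c h v).den_pos) h1
    have h3 := Nat.le_of_dvd (c h v).den_pos hdvd
    omega
  set u : G → E → ZMod ℓ := fun g x => if g • x ∈ Φ then (1 : ZMod ℓ) else 0 with hu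
  -- the translates mod `ℓ` lie in the span of the `u (gv v)`, `v ∈ bF`
  have hkey : ∀ h : G, u h ∈ Submodule.span (ZMod ℓ) (bF.image fun v => u (gv v) : Set (E → ZMod ℓ)) := by
    intro h
    -- clear denominators: `D = ∏_v den(c h v)`, `z v = num · (D / den)`
    set D : ℕ := ∏ v ∈ bF, (c h v).den with hD
    have hDℓ : (D : ZMod ℓ) ≠ 0 := by
      rw [Ne, ZMod.natCast_eq_zero_iff, hD]
      intro hdvd
      obtain ⟨v, hv, hv'⟩ := (Nat.Prime.prime hℓ).dvd_finsetProd_iff _ |>.1 hdvd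
      exact hden h v hv hv'
    have hdvdD : ∀ v ∈ bF, (c h v).den ∣ D := fun v hv => Finset.dvd_prod_of_mem _ hv
    -- integer coefficients
    let z : (E → ℚ) → ℤ := fun v => (c h v).num * (D / (c h v).den : ℕ)
    have hz : ∀ v ∈ bF, (z v : ℚ) = (D : ℚ) * c h v := by
      intro v hv
      have hden0 : ((c h v).den : ℚ) ≠ 0 := Nat.cast_ne_zero.2 (c h v).den_pos.ne'
      simp only [z, Int.cast_mul, Int.cast_natCast]
      rw [Nat.cast_div (hdvdD v hv) hden0]
      have := Rat.mul_den_eq_num (c h v)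
      field_simp
      rw [← this]
      ring
    -- the rational identity at each point, as an identity of integers
    have hpt : ∀ x : E, (D : ℤ) * (if h • x ∈ Φ then (1 : ℤ) else 0) =
        ∑ v ∈ bF, z v * (if gv v • x ∈ Φ then (1 : ℤ) else 0) := by
      intro x
      have h1 := congrFun (hc h) x
      rw [Finset.sum_apply] at h1
      apply Int.cast_injective (α := ℚ)
      push_cast
      have h2 : ∀ v ∈ bF, (v : E → ℚ) x = if gv v • x ∈ Φ then (1 : ℚ) else 0 := by
        intro v hv
        have e1 : v x = translateInd Φ (gv v) x := by rw [hgv v hv]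
        rw [e1]
        by_cases hx : gv v • x ∈ Φ
        · rw [translateInd_of_mem hx, if_pos hx]
        · rw [translateInd_of_not_mem hx, if_neg hx]
      have h3 : translateInd Φ h x = if h • x ∈ Φ then (1 : ℚ) else 0 := by
        by_cases hx : h • x ∈ Φ
        · rw [translateInd_of_mem hx, if_pos hx]
        · rw [translateInd_of_not_mem hx, if_neg hx]
      rw [← h3, ← h1, Finset.mul_sum]
      refine Finset.sum_congr rfl fun v hv => ?_
      rw [Pi.smul_apply, smul_eq_mul, h2 v hv, hz v hv, mul_assoc]
    -- reduce mod `ℓ`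
    have hmod : (D : ZMod ℓ) • u h = ∑ v ∈ bF, (z v : ZMod ℓ) • u (gv v) := by
      funext x
      simp only [hu, Pi.smul_apply, Finset.sum_apply, smul_eq_mul]
      have := congrArg (Int.cast : ℤ → ZMod ℓ) (hpt x)
      push_cast at this
      exact this
    have hmem : (D : ZMod ℓ) • u h ∈ Submodule.span (ZMod ℓ) (bF.image fun v => u (gv v) : Set (E → ZMod ℓ)) := by
      rw [hmod]
      refine Submodule.sum_mem _ fun v hv => Submodule.smul_mem _ _ (Submodule.subset_span ?_)
      rw [Finset.coe_image]
      exact ⟨v, hv, rfl⟩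
    have := Submodule.smul_mem _ (D : ZMod ℓ)⁻¹ hmem
    rwa [smul_smul, inv_mul_cancel₀ hDℓ, one_smul] at this
  have hle : Submodule.span (ZMod ℓ) (Set.range u) ≤
      Submodule.span (ZMod ℓ) (bF.image fun v => u (gv v) : Set (E → ZMod ℓ)) := by
    rw [Submodule.span_le]
    rintro _ ⟨h, rfl⟩
    exact hkey h
  calc Module.finrank (ZMod ℓ) (Submodule.span (ZMod ℓ) (Set.range u))
      ≤ Module.finrank (ZMod ℓ) (Submodule.span (ZMod ℓ) (bF.image fun v => u (gv v) : Set (E → ZMod ℓ))) :=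
        Submodule.finrank_mono hle
    _ ≤ (bF.image fun v => u (gv v)).card := finrank_span_finset_le_card _
    _ ≤ bF.card := Finset.card_image_le
    _ = typeRank G Φ := hrank.symm

end Reduction


/-! ### §5 Murty's bound -/

section Murty

variable {G : Type*} [Group G] [Fintype G] {E : Type*} [Fintype E] [MulAction G E]

/-- `v_p` is monotone along divisibility. [folklore] -/
private theorem padicValNat_le_of_dvd {p a b : ℕ} [Fact p.Prime] (hb : b ≠ 0) (h : a ∣ b) :
    padicValNat p a ≤ padicValNat p b :=
  (padicValNat_dvd_iff_le hb).1 (pow_padicValNat_dvd.trans h)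

/-- **Mai 1989, Proposition 2 (Murty's bound), abstract integer form.**  If the finite group `G` permutes the
translates of `Φ ⊆ E` faithfully ("`τ : G → GL(Y)` is an injective group homomorphism"), then for every odd prime `p`:
`(p − 1)² · v_p(|G|) ≤ p · rank(Φ)` — i.e. `rank(K, S) ≥ (p − 1)² α / p` for `p^α ∥ [K : ℚ]/2` when `G = Gal(K/ℚ)`
(`|G| = [K : ℚ]`, and `v_p([K:ℚ]) = v_p([K:ℚ]/2)` for odd `p`). [cite: Mai1989, §2 Prop. 2]
[cite: Gordon1999HodgeAVSurvey, §9.4.4 (Proposition [B.72] Prop. 2)] -/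
theorem sq_mul_padicValNat_card_le_mul_typeRank (Φ : Set E)
    (hfaith : ∀ g : G, (∀ h : G, translateInd Φ (h * g) = translateInd Φ h) → g = 1)
    {p : ℕ} (hp : p.Prime) (hp2 : p ≠ 2) :
    (p - 1) ^ 2 * padicValNat p (Fintype.card G) ≤ p * typeRank G Φ := by
  classical
  haveI := Fact.mk hp
  obtain ⟨N, hN⟩ := exists_forall_finrank_span_translates_le_typeRank (G := G) Φ
  obtain ⟨ℓ, hℓN, hℓ, hpℓ, hdiv, hv1⟩ := exists_prime_gt_primitiveRoot (p := p) hp2 N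
  haveI := Fact.mk hℓ
  have hn := hN ℓ hℓN hℓ
  have hdvd := card_dvd_card_GL_span_translates (G := G) (ZMod ℓ) Φ hfaith
  rw [Matrix.card_GL_field, ZMod.card, Nat.card_eq_fintype_card] at hdvd
  set n := Module.finrank (ZMod ℓ) (Submodule.span (ZMod ℓ)
    (Set.range fun g : G => fun x : E => if g • x ∈ Φ then (1 : ZMod ℓ) else 0)) with hn_def
  have hq : 1 < ℓ := hℓ.one_lt
  have hprod : (∏ i : Fin n, (ℓ ^ n - ℓ ^ (i : ℕ))) ≠ 0 := by
    refine Finset.prod_ne_zero_iff.2 fun i _ => ?_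
    have : ℓ ^ (i : ℕ) < ℓ ^ n := Nat.pow_lt_pow_right hq i.2
    omega
  calc (p - 1) ^ 2 * padicValNat p (Fintype.card G)
      ≤ (p - 1) ^ 2 * padicValNat p (∏ i : Fin n, (ℓ ^ n - ℓ ^ (i : ℕ))) :=
        Nat.mul_le_mul_left _ (padicValNat_le_of_dvd hprod hdvd)
    _ ≤ p * n := sq_mul_padicValNat_prod_le hp2 hq hpℓ hdiv hv1 n
    _ ≤ p * typeRank G Φ := Nat.mul_le_mul_left _ hn

omit [Fintype G] [Fintype E] in
/-- Faithfulness on the translates from the tree's primitivity: if the translates of `Φ` separate the points of `E`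
(`IsPrimitive`, Kubota) and `G` acts faithfully on `E`, then an element fixing every translate is trivial — it moves
no point, since `x` and `gx` lie in the same translates. [cite: Mai1989, §2 Prop. 2 (proof)] -/
theorem eq_one_of_forall_translateInd_mul_eq [MulAction.IsPretransitive G E] [FaithfulSMul G E] {Φ : Set E}
    {φh : E} (hprim : IsPrimitive G Φ φh) (g : G) (hg : ∀ h : G, translateInd Φ (h * g) = translateInd Φ h) :
    g = 1 := by
  have hsep := (isPrimitive_iff_forall_eq Φ φh).1 hprim
  have hfix : ∀ x : E, g • x = x := by
    intro x
    refine hsep (g • x) x fun k => ?_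
    have h1 := congrFun (hg k) x
    rw [translateInd_mul] at h1
    constructor
    · intro hk
      by_contra hk'
      rw [translateInd_of_mem hk, translateInd_of_not_mem hk'] at h1
      exact one_ne_zero h1
    · intro hk
      by_contra hk'
      rw [translateInd_of_not_mem hk', translateInd_of_mem hk] at h1
      exact zero_ne_one h1
  exact FaithfulSMul.eq_of_smul_eq_smul fun x => by rw [hfix x, one_smul]

/-- **Murty's bound for a primitive type under a faithful transitive action** (`E = Hom(K, ℂ)` under the Galois group
`G` of the Galois closure of `K`, `(K, S)` simple): `(p − 1)² · v_p(|G|) ≤ p · rank(Φ)` for every odd prime `p`.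
[cite: Mai1989, §2 Prop. 2] -/
theorem sq_mul_padicValNat_card_le_mul_typeRank_of_isPrimitive [MulAction.IsPretransitive G E] [FaithfulSMul G E]
    {Φ : Set E} {φh : E} (hprim : IsPrimitive G Φ φh) {p : ℕ} (hp : p.Prime) (hp2 : p ≠ 2) :
    (p - 1) ^ 2 * padicValNat p (Fintype.card G) ≤ p * typeRank G Φ :=
  sq_mul_padicValNat_card_le_mul_typeRank Φ (fun g hg => eq_one_of_forall_translateInd_mul_eq hprim g hg) hp hp2

/-- **Mai 1989, Proposition 2, for `G` acting on itself** (`K` Galois over `ℚ`, `G = Gal(K/ℚ)`, the embeddings a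
`G`-torsor): if `S ⊆ G` has trivial stabiliser under right translation — `(∀ k, k g ∈ S ↔ k ∈ S) ⟹ g = 1`, i.e.
`(K, S)` is simple — then `(p − 1)² · v_p(|G|) ≤ p · rank(S)` for every odd prime `p`; with `|G| = [K:ℚ] = 2d` and
`p^α ∥ d` this is `rank(K, S) ≥ (p − 1)² α / p`. [cite: Mai1989, §2 Prop. 2]
[cite: Gordon1999HodgeAVSurvey, §9.4.4 (Proposition [B.72] Prop. 2)] -/
theorem sq_mul_padicValNat_card_le_mul_typeRank_of_forall_mul_mem_iff (S : Set G)
    (hsimple : ∀ g : G, (∀ k : G, k * g ∈ S ↔ k ∈ S) → g = 1) {p : ℕ} (hp : p.Prime) (hp2 : p ≠ 2) :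
    (p - 1) ^ 2 * padicValNat p (Fintype.card G) ≤ p * typeRank G S := by
  refine sq_mul_padicValNat_card_le_mul_typeRank S (fun g hg => hsimple g fun k => ?_) hp hp2
  have h1 := congrFun (hg k) 1
  rw [translateInd_mul, smul_eq_mul, mul_one] at h1
  constructor
  · intro hk
    by_contra hk'
    rw [translateInd_of_mem (show k • g ∈ S by rwa [smul_eq_mul]),
      translateInd_of_not_mem (show k • (1 : G) ∉ S by rwa [smul_eq_mul, mul_one])] at h1
    exact one_ne_zero h1
  · intro hk
    by_contra hk'
    rw [translateInd_of_not_mem (show k • g ∉ S by rwa [smul_eq_mul]),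
      translateInd_of_mem (show k • (1 : G) ∈ S by rwa [smul_eq_mul, mul_one])] at h1
    exact zero_ne_one h1

end Murty


/-! ### §6 The Minkowski–Serre form: `v_p(|G|) ≤ M(rank Φ, p) = [r/(p−1)] + v_p([r/(p−1)]!)`

Murty's count is Minkowski's (1887): a finite subgroup `A ⊂ GL_n(ℚ)` has `v_ℓ(A) ≤ M(n, ℓ)`,
`M(n, ℓ) = [n/(ℓ−1)] + [n/(ℓ(ℓ−1))] + [n/(ℓ²(ℓ−1))] + ⋯` (Serre, *Bounds for the orders of the finite subgroups of
`G(k)`*, Lecture I, Thm. 1 (i)), proved for `ℓ > 2` exactly as in §1–§5: "`A → GL_n(ℤ/pℤ)` is injective … we choose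
`p` such that the image of `p` in `(ℤ/ℓ²ℤ)*` is a generator … `a(p) = [n/(ℓ−1)] + Σ_{1 ≤ j ≤ [n/(ℓ−1)]} v_ℓ(j)
= [n/(ℓ−1)] + v_ℓ([n/(ℓ−1)]!) = [n/(ℓ−1)] + [n/(ℓ(ℓ−1))] + ⋯ = M(n, ℓ)`" (§1.3.3).  Here the group `G` permuting
the translates of `Φ` faithfully is a finite subgroup of `GL(W) ≅ GL_r(ℚ)`, `r = rank(Φ)` (Dodson: "a primitive
CM-type gives a faithful linear representation defined over the rationals of the group `G = Gal(Kᶜ/ℚ)`", Thm. 1.14),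
and §1–§4 give the sharper form of §5: `v_p(|G|) ≤ M(rank Φ, p)` — from which §5's `(p − 1)² · v_p(|G|) ≤ p · rank`
follows by Legendre. -/

section MinkowskiCount

variable {p : ℕ} [hp : Fact p.Prime]

section Count

variable (hp2 : p ≠ 2) {q : ℕ} (hq : 1 < q) (hpq : ¬ p ∣ q)
  (hdiv : ∀ i, p ∣ q ^ i - 1 → (p - 1) ∣ i) (hv1 : padicValNat p (q ^ (p - 1) - 1) = 1)
include hp2 hq hpq hdiv hv1

/-- **Serre's count** (proof of Minkowski's theorem, `ℓ > 2`): for `q` of order `p − 1` modulo `p` with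
`v_p(q^{p−1} − 1) = 1` (e.g. a prime generating `(ℤ/p²ℤ)ˣ`), the `p`-part of `|GL_r(𝔽_q)| = q^{r(r−1)/2} ∏ (q^i − 1)` is
`v_p(∏_{i<r} (q^r − q^i)) = [r/(p−1)] + v_p([r/(p−1)]!)` — "`a(p) = Σ_{i=1}^{n} v_ℓ(p^i − 1)` … `p^i − 1` is divisible
by `ℓ` only if `i` is divisible by `ℓ − 1` … `v_ℓ(p^i − 1) = 1 + v_ℓ(i)` if `i` is divisible by `ℓ − 1` …
`a(p) = [n/(ℓ−1)] + v_ℓ([n/(ℓ−1)]!)`". [cite: Serre2007BoundsFiniteSubgroups, Lecture I §1.3.3 (proof of Thm. 1 (i))] -/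
theorem padicValNat_prod_pow_sub_pow_eq (r : ℕ) :
    padicValNat p (∏ i : Fin r, (q ^ r - q ^ (i : ℕ))) = r / (p - 1) + padicValNat p (r / (p - 1)).factorial := by
  have hp3 : 3 ≤ p := by
    have := hp.out.two_le
    omega
  have hfac : ∀ i : Fin r, q ^ r - q ^ (i : ℕ) = q ^ (i : ℕ) * (q ^ (r - i) - 1) := by
    intro i
    rw [Nat.mul_sub_one, ← pow_add, Nat.add_sub_cancel' (le_of_lt i.2)]
  have hne : ∀ i : Fin r, q ^ r - q ^ (i : ℕ) ≠ 0 := by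
    intro i
    have : q ^ (i : ℕ) < q ^ r := Nat.pow_lt_pow_right hq i.2
    omega
  have hval : padicValNat p (∏ i : Fin r, (q ^ r - q ^ (i : ℕ))) = ∑ k ∈ range r, padicValNat p (q ^ (k + 1) - 1) := by
    rw [padicValNat_prod _ _ fun i _ => hne i]
    have h1 : ∀ i : Fin r, padicValNat p (q ^ r - q ^ (i : ℕ)) = padicValNat p (q ^ (r - i) - 1) := by
      intro i
      have hq0 : q ^ (i : ℕ) ≠ 0 := pow_ne_zero _ (by omega)
      have hq1 : q ^ (r - i) - 1 ≠ 0 := by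
        have : 1 < q ^ (r - (i : ℕ)) := Nat.one_lt_pow (by have := i.2; omega) hq
        omega
      rw [hfac, padicValNat.mul hq0 hq1, padicValNat.pow, padicValNat.eq_zero_of_not_dvd hpq, mul_zero, zero_add]
    simp_rw [h1]
    rw [Fin.sum_univ_eq_sum_range (fun i => padicValNat p (q ^ (r - i) - 1)) r, ← sum_range_reflect]
    refine sum_congr rfl fun k hk => ?_
    rw [mem_range] at hk
    have hk' : r - (r - 1 - k) = k + 1 := by omega
    rw [hk']
  rw [hval, sum_range_eq_sum_range_div (d := p - 1) (by omega) (fun m => padicValNat p (q ^ m - 1))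
    (fun m hm => padicValNat.eq_zero_of_not_dvd fun h => hm (hdiv m h))]
  have hterm : ∀ j, padicValNat p (q ^ ((p - 1) * (j + 1)) - 1) = 1 + padicValNat p (j + 1) := by
    intro j
    have h := padicValNat_pow_sub_one hp2 hq hpq hdiv hv1 ((p - 1) * (j + 1) - 1)
    have h3 : 1 ≤ (p - 1) * (j + 1) := Nat.one_le_iff_ne_zero.2 (Nat.mul_ne_zero (by omega) (by omega))
    rw [Nat.sub_add_cancel h3, if_pos (dvd_mul_right _ _), Nat.mul_div_cancel_left _ (by omega)] at h
    exact h
  simp_rw [hterm]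
  rw [sum_add_distrib, sum_const, card_range, smul_eq_mul, mul_one, sum_range_padicValNat_succ_eq]

end Count

/-- **Minkowski's `M(n, ℓ)` in closed form**: `[n/(ℓ−1)] + v_ℓ([n/(ℓ−1)]!) = Σ_{0 ≤ k < b} [n/(ℓ^k(ℓ−1))]` for any
`b > log_ℓ n` (Legendre's formula for `v_ℓ` of a factorial; the terms with `ℓ^k > n` vanish).
[cite: Serre2007BoundsFiniteSubgroups, Lecture I §1.1 Thm. 1 and §1.3.3] -/
theorem div_add_padicValNat_factorial_eq_sum (n : ℕ) {b : ℕ} (hb : Nat.log p n < b) :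
    n / (p - 1) + padicValNat p (n / (p - 1)).factorial = ∑ k ∈ range b, n / (p ^ k * (p - 1)) := by
  have hlog : Nat.log p (n / (p - 1)) < b := lt_of_le_of_lt (Nat.log_mono_right (Nat.div_le_self _ _)) hb
  rw [padicValNat_factorial hlog, Finset.range_eq_Ico]
  have hb0 : 0 < b := by omega
  rw [← Finset.insert_Ico_add_one_left_eq_Ico hb0, sum_insert (by simp), pow_zero, one_mul]
  congr 1
  refine sum_congr rfl fun k _ => ?_
  rw [Nat.div_div_eq_div_mul, mul_comm]

end MinkowskiCount

section MinkowskiGroup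

variable {G : Type*} [Group G] [Fintype G] {E : Type*} [Fintype E] [MulAction G E]

/-- **Minkowski's theorem for the groups of §5** (Serre, Thm. 1 (i): "If `A` is a finite subgroup of `GL_n(ℚ)`, we have
`v_ℓ(A) ≤ M(n, ℓ)`", `ℓ > 2`; Dodson Thm. 1.14: "`G` must be isomorphic to a (finite) subgroup of `GL_r(ℚ)`"): if the
finite group `G` permutes the translates of `Φ ⊆ E` faithfully (so that `G ⊂ GL(W) ≅ GL_r(ℚ)`, `r = rank Φ`), then
for every odd prime `p`: `v_p(|G|) ≤ [r/(p−1)] + v_p([r/(p−1)]!) = M(r, p)`.  Same road as §5 (`G ↪ GL(W_𝔽_q)`,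
`dim W_𝔽_q ≤ r`, `q` a prime generating `(ℤ/p²)ˣ`), with Serre's exact count in place of Murty's estimate.
[cite: Serre2007BoundsFiniteSubgroups, Lecture I Thm. 1 (i)] [cite: Dodson1987, Thm. 1.14 (pp. 55–56)] -/
theorem padicValNat_card_le_rank_div_add_padicValNat_factorial (Φ : Set E)
    (hfaith : ∀ g : G, (∀ h : G, translateInd Φ (h * g) = translateInd Φ h) → g = 1)
    {p : ℕ} (hp : p.Prime) (hp2 : p ≠ 2) :
    padicValNat p (Fintype.card G) ≤
      typeRank G Φ / (p - 1) + padicValNat p (typeRank G Φ / (p - 1)).factorial := by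
  classical
  haveI := Fact.mk hp
  obtain ⟨N, hN⟩ := exists_forall_finrank_span_translates_le_typeRank (G := G) Φ
  obtain ⟨ℓ, hℓN, hℓ, hpℓ, hdiv, hv1⟩ := exists_prime_gt_primitiveRoot (p := p) hp2 N
  haveI := Fact.mk hℓ
  have hn := hN ℓ hℓN hℓ
  have hdvd := card_dvd_card_GL_span_translates (G := G) (ZMod ℓ) Φ hfaith
  rw [Matrix.card_GL_field, ZMod.card, Nat.card_eq_fintype_card] at hdvd
  set n := Module.finrank (ZMod ℓ) (Submodule.span (ZMod ℓ)
    (Set.range fun g : G => fun x : E => if g • x ∈ Φ then (1 : ZMod ℓ) else 0)) with hn_def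
  have hq : 1 < ℓ := hℓ.one_lt
  have hprod : (∏ i : Fin n, (ℓ ^ n - ℓ ^ (i : ℕ))) ≠ 0 := by
    refine Finset.prod_ne_zero_iff.2 fun i _ => ?_
    have : ℓ ^ (i : ℕ) < ℓ ^ n := Nat.pow_lt_pow_right hq i.2
    omega
  have hmono : n / (p - 1) ≤ typeRank G Φ / (p - 1) := Nat.div_le_div_right hn
  calc padicValNat p (Fintype.card G)
      ≤ padicValNat p (∏ i : Fin n, (ℓ ^ n - ℓ ^ (i : ℕ))) := padicValNat_le_of_dvd hprod hdvd
    _ = n / (p - 1) + padicValNat p (n / (p - 1)).factorial := padicValNat_prod_pow_sub_pow_eq hp2 hq hpℓ hdiv hv1 n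
    _ ≤ typeRank G Φ / (p - 1) + padicValNat p (typeRank G Φ / (p - 1)).factorial :=
        add_le_add hmono (padicValNat_le_of_dvd (Nat.factorial_ne_zero _) (Nat.factorial_dvd_factorial hmono))

/-- Minkowski's bound for a primitive type under a faithful transitive action (`E = Hom(K, ℂ)` under the Galois group
of the Galois closure, `(K, S)` simple): `v_p(|G|) ≤ M(rank Φ, p)` for every odd prime `p` — the `ℓ`-part of Dodson's
"`p`-Sylow bound" without its refinement `+ e_p`. [cite: Serre2007BoundsFiniteSubgroups, Lecture I Thm. 1 (i)]
[cite: Dodson1987, Thm. 1.14 (2) (pp. 55–56)] -/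
theorem padicValNat_card_le_rank_div_add_padicValNat_factorial_of_isPrimitive [MulAction.IsPretransitive G E]
    [FaithfulSMul G E] {Φ : Set E} {φh : E} (hprim : IsPrimitive G Φ φh) {p : ℕ} (hp : p.Prime) (hp2 : p ≠ 2) :
    padicValNat p (Fintype.card G) ≤
      typeRank G Φ / (p - 1) + padicValNat p (typeRank G Φ / (p - 1)).factorial :=
  padicValNat_card_le_rank_div_add_padicValNat_factorial Φ
    (fun g hg => eq_one_of_forall_translateInd_mul_eq hprim g hg) hp hp2

/-- Minkowski's bound for `G` acting on itself and `S ⊆ G` with trivial right stabiliser (`K` Galois, `(K, S)` simple):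
`v_p(|G|) ≤ M(rank S, p)` for every odd prime `p`. [cite: Serre2007BoundsFiniteSubgroups, Lecture I Thm. 1 (i)]
[cite: Mai1989, §2 Prop. 2 (proof)] -/
theorem padicValNat_card_le_rank_div_add_padicValNat_factorial_of_forall_mul_mem_iff (S : Set G)
    (hsimple : ∀ g : G, (∀ k : G, k * g ∈ S ↔ k ∈ S) → g = 1) {p : ℕ} (hp : p.Prime) (hp2 : p ≠ 2) :
    padicValNat p (Fintype.card G) ≤
      typeRank G S / (p - 1) + padicValNat p (typeRank G S / (p - 1)).factorial := by
  refine padicValNat_card_le_rank_div_add_padicValNat_factorial S (fun g hg => hsimple g fun k => ?_) hp hp2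
  have h1 := congrFun (hg k) 1
  rw [translateInd_mul, smul_eq_mul, mul_one] at h1
  constructor
  · intro hk
    by_contra hk'
    rw [translateInd_of_mem (show k • g ∈ S by rwa [smul_eq_mul]),
      translateInd_of_not_mem (show k • (1 : G) ∉ S by rwa [smul_eq_mul, mul_one])] at h1
    exact one_ne_zero h1
  · intro hk
    by_contra hk'
    rw [translateInd_of_not_mem (show k • g ∉ S by rwa [smul_eq_mul]),
      translateInd_of_mem (show k • (1 : G) ∈ S by rwa [smul_eq_mul, mul_one])] at h1
    exact zero_ne_one h1

end MinkowskiGroup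

/-! ### §7 Dodson's refinement `+ e_p`, `e_p = 2`: `v_p(|G|) ≤ M(rank Φ − 2, p)` for a CM type

Dodson 1987, Thm. 1.14 ("`p`-Sylow bound") and its proof: "a primitive CM-type gives a faithful linear representation
defined over the rationals of the group `G = Gal(Kᶜ/ℚ)`.  A necessary condition for `Rank(Φ) = r` is then that `G` must
be isomorphic to a (finite) subgroup of `GL_{r−1}(ℚ)`, since we may split off a 1-dimensional trivial representation
corresponding to `Φ + Φ̄` … `B(n) ≥ L(n) = max_p (R(p, n) + e_p)`, where `e_p = 2` if `p` is odd … the value of `e_p`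
for `p` odd follows from the independence of the norm `N_P(Φ) = Σ_{g ∈ P} Φᵍ` from `Φ + Φ̄`, which depends upon `p`
being odd" (`P` the `p`-Sylow subgroup of `G`).  Read with Minkowski's theorem (§6) this is: `v_p(|G|) = v_p(|P|) ≤
M(rank Φ − 2, p)`.  PROOF used here (the printed one, with Minkowski's reduction done on the quotient): `P` fixes
`𝟙 = Φ + Φ̄` and `n_P = N_P(𝟙_Φ)`, which stay independent modulo a prime `q > |P|` (`n_P(x) + n_P(ρx) = |P|` is odd);
`P` acts on `W_𝔽_q / ⟨𝟙, n_P⟩` FAITHFULLY — an element acting trivially there is `1 + T` on `W_𝔽_q` with `T² = 0`,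
so `(1 + T)^{|P|} = 1 + |P|·T = 1` forces `T = 0` (`q ∤ |P|`), and then it fixes every translate; hence
`|P| ∣ |GL_{m}(𝔽_q)|`, `m = dim W_𝔽_q − 2 ≤ rank − 2`, and Serre's count (§6) gives `v_p(|P|) ≤ M(m, p) ≤ M(rank − 2, p)`. -/

section SylowQuotient

variable {G : Type*} [Group G] [Fintype G] {E : Type*} [Fintype E] [MulAction G E]

open scoped Classical in
/-- **A subgroup `P` fixing `𝟙` and `n_P = Σ_{k ∈ P} 𝟙_{k⁻¹Φ}` embeds in `GL(W_F / ⟨𝟙, n_P⟩)`** (`F` a finite field with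
`|P| ≠ 0` in `F`, `Φ` a CM type whose translates `G` permutes faithfully, `n_P` not constant in `F^E`): an element of
`P` trivial on the quotient is unipotent `1 + T`, `T² = 0`, on `W_F`, and `(1 + T)^{|P|} = 1 + |P| T = 1` gives `T = 0`;
so `|P|` divides `|GL_{n−2}(F)|`, `n = dim_F W_F` — Dodson's "we may split off" the trivial summands `Φ + Φ̄` and
`N_P(Φ)`, done modulo `q`. [cite: Dodson1987, Thm. 1.14 (proof, pp. 55–56)] -/
theorem card_subgroup_dvd_card_GL_sub_two (F : Type*) [Field F] [Fintype F] {ρ : G} {Φ : Set E}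
    (hΦ : IsCMTypeWith ρ Φ)
    (hfaith : ∀ g : G, (∀ h : G, translateInd Φ (h * g) = translateInd Φ h) → g = 1)
    (P : Subgroup G) (hPF : (Nat.card P : F) ≠ 0)
    (hnc : ∃ x y : E,
      (∑ k : P, (if (k : G) • x ∈ Φ then (1 : F) else 0)) ≠ ∑ k : P, (if (k : G) • y ∈ Φ then (1 : F) else 0)) :
    Nat.card P ∣ Nat.card (GL (Fin (Module.finrank F (Submodule.span F
      (Set.range fun g : G => fun x : E => if g • x ∈ Φ then (1 : F) else 0)) - 2)) F) := by
  set u : G → E → F := fun g x => if g • x ∈ Φ then (1 : F) else 0 with hu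
  set W : Submodule F (E → F) := Submodule.span F (Set.range u) with hW
  -- (§3) the linear maps `f ↦ f ∘ (g⁻¹ • ·)` permute the translates and preserve `W`
  have hM : ∀ g h : G, LinearMap.funLeft F F (fun x : E => g⁻¹ • x) (u h) = u (h * g⁻¹) := by
    intro g h
    funext x
    simp only [LinearMap.funLeft_apply, hu, mul_smul]
  have hstab : ∀ g : G, ∀ v ∈ W, LinearMap.funLeft F F (fun x : E => g⁻¹ • x) v ∈ W := by
    intro g v hv
    have hle : W.map (LinearMap.funLeft F F (fun x : E => g⁻¹ • x)) ≤ W := by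
      rw [hW, Submodule.map_span_le]
      rintro _ ⟨h, rfl⟩
      rw [hM]
      exact Submodule.subset_span ⟨h * g⁻¹, rfl⟩
    exact hle (Submodule.mem_map_of_mem hv)
  let ρW : G →* Module.End F W :=
    { toFun := fun g => (LinearMap.funLeft F F (fun x : E => g⁻¹ • x)).restrict (hstab g)
      map_one' := by
        apply LinearMap.ext
        intro v
        apply Subtype.ext
        funext x
        simp [LinearMap.restrict_apply]
      map_mul' := fun g g' => by
        apply LinearMap.ext
        intro v
        apply Subtype.ext
        funext x
        simp [LinearMap.restrict_apply, mul_smul] }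
  have hρW : ∀ (g : G) (v : W) (x : E), ((ρW g v : W) : E → F) x = (v : E → F) (g⁻¹ • x) := fun g v x => rfl
  -- the two `P`-fixed vectors `𝟙 = u 1 + u ρ` and `n_P = Σ_{k ∈ P} u k`
  have hone_eq : (fun _ : E => (1 : F)) = u 1 + u ρ := by
    funext x
    simp only [hu, Pi.add_apply, one_smul]
    by_cases hx : x ∈ Φ
    · rw [if_pos hx, if_neg (fun h => (hΦ.rho_smul_mem_iff x).1 h hx), add_zero]
    · rw [if_neg hx, if_pos ((hΦ.rho_smul_mem_iff x).2 hx), zero_add]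
  have hone_mem : (fun _ : E => (1 : F)) ∈ W := by
    rw [hone_eq]
    exact W.add_mem (Submodule.subset_span ⟨1, rfl⟩) (Submodule.subset_span ⟨ρ, rfl⟩)
  set nP : E → F := ∑ k : P, u (k : G) with hnP
  have hnP_apply : ∀ x : E, nP x = ∑ k : P, (if (k : G) • x ∈ Φ then (1 : F) else 0) := by
    intro x
    rw [hnP, Finset.sum_apply]
  have hnP_mem : nP ∈ W := W.sum_mem fun k _ => Submodule.subset_span ⟨(k : G), rfl⟩
  -- `P` fixes both
  have hfix_one : ∀ k : P, ρW (k : G) ⟨_, hone_mem⟩ = ⟨_, hone_mem⟩ := by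
    intro k
    apply Subtype.ext
    funext x
    rw [hρW]
  have hfix_nP : ∀ k : P, ρW (k : G) ⟨nP, hnP_mem⟩ = ⟨nP, hnP_mem⟩ := by
    intro k
    apply Subtype.ext
    funext x
    rw [hρW]
    change nP ((k : G)⁻¹ • x) = nP x
    rw [hnP_apply, hnP_apply]
    -- reindex `k' ↦ k' k⁻¹`
    refine Finset.sum_equiv (Equiv.mulRight k⁻¹) (fun _ => by simp) fun k' _ => ?_
    simp only [Equiv.coe_mulRight, Subgroup.coe_mul, Subgroup.coe_inv, mul_smul]
  -- the plane `U = ⟨𝟙, n_P⟩ ≤ W` and its dimension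
  set e1 : W := ⟨_, hone_mem⟩ with he1
  set e2 : W := ⟨nP, hnP_mem⟩ with he2
  set U : Submodule F W := Submodule.span F (Set.range ![e1, e2]) with hU_def
  obtain ⟨x₁, y₁, hxy⟩ := hnc
  have hli : LinearIndependent F ![e1, e2] := by
    rw [LinearIndependent.pair_iff]
    intro s t hst
    have hx : ∀ x : E, s + t * nP x = 0 := fun x => by
      have h1 := congrArg (fun w : W => (w : E → F) x) hst
      simpa [he1, he2] using h1
    by_cases ht : t = 0
    · refine ⟨?_, ht⟩
      have h1 := hx x₁
      rwa [ht, zero_mul, add_zero] at h1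
    · exfalso
      apply hxy
      rw [← hnP_apply, ← hnP_apply]
      have h1 := hx x₁
      have h2 := hx y₁
      have h3 : t * (nP x₁ - nP y₁) = 0 := by linear_combination h1 - h2
      rcases mul_eq_zero.1 h3 with h4 | h4
      · exact absurd h4 ht
      · exact sub_eq_zero.1 h4
  have hU2 : Module.finrank F U = 2 := by
    rw [hU_def, finrank_span_eq_card hli, Fintype.card_fin]
  -- `U` is `P`-stable (pointwise fixed) and `P` acts on `W ⧸ U`
  have hUle : ∀ k : P, U ≤ U.comap (ρW (k : G)) := by
    intro k
    rw [hU_def, Submodule.span_le]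
    rintro _ ⟨i, rfl⟩
    rw [SetLike.mem_coe, Submodule.mem_comap]
    fin_cases i
    · change ρW (k : G) e1 ∈ Submodule.span F (Set.range ![e1, e2])
      rw [hfix_one k]
      exact Submodule.subset_span ⟨0, rfl⟩
    · change ρW (k : G) e2 ∈ Submodule.span F (Set.range ![e1, e2])
      rw [hfix_nP k]
      exact Submodule.subset_span ⟨1, rfl⟩
  let ρQ : P →* Module.End F (W ⧸ U) :=
    { toFun := fun k => U.mapQ U (ρW (k : G)) (hUle k)
      map_one' := by
        apply Submodule.linearMap_qext
        apply LinearMap.ext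
        intro w
        simp [Submodule.mapQ_apply]
      map_mul' := fun k k' => by
        apply Submodule.linearMap_qext
        apply LinearMap.ext
        intro w
        simp [Submodule.mapQ_apply, Module.End.mul_apply] }
  -- faithfulness on the quotient
  have hinj : Function.Injective ρQ.toHomUnits := by
    rw [injective_iff_map_eq_one]
    intro k hk
    have hk' : ρQ k = 1 := by
      have := congrArg (fun z : (Module.End F (W ⧸ U))ˣ => (z : Module.End F (W ⧸ U))) hk
      simpa using this
    -- `T = ρW k − 1` maps `W` into `U` and kills `U`
    set T : Module.End F W := ρW (k : G) - 1 with hT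
    have hTU : ∀ w : W, T w ∈ U := by
      intro w
      have h1 : U.mkQ (ρW (k : G) w) = U.mkQ w := by
        have h2 := LinearMap.congr_fun hk' (U.mkQ w)
        rw [Module.End.one_apply] at h2
        rw [← h2]
        rfl
      rw [hT, LinearMap.sub_apply, Module.End.one_apply, ← Submodule.Quotient.eq, ← Submodule.mkQ_apply,
        ← Submodule.mkQ_apply]
      exact h1
    have hTU0 : ∀ w ∈ U, T w = 0 := by
      intro w hw
      rw [hU_def] at hw
      refine Submodule.span_induction ?_ ?_ ?_ ?_ hw
      · rintro _ ⟨i, rfl⟩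
        fin_cases i
        · show T e1 = 0
          rw [hT, LinearMap.sub_apply, Module.End.one_apply, hfix_one k, sub_self]
        · show T e2 = 0
          rw [hT, LinearMap.sub_apply, Module.End.one_apply, hfix_nP k, sub_self]
      · exact map_zero T
      · intro a b _ _ ha hb
        rw [map_add, ha, hb, add_zero]
      · intro c a _ ha
        rw [map_smul, ha, smul_zero]
    have hT2 : T * T = 0 := by
      apply LinearMap.ext
      intro w
      rw [Module.End.mul_apply, LinearMap.zero_apply]
      exact hTU0 _ (hTU w)
    -- `(1 + T)^N = 1 + N • T`
    have hpow : ∀ N : ℕ, (ρW (k : G)) ^ N = 1 + N • T := by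
      intro N
      have hk1 : ρW (k : G) = 1 + T := by rw [hT]; abel
      induction N with
      | zero => rw [pow_zero, zero_smul, add_zero]
      | succ N ih =>
        rw [pow_succ, ih, hk1, add_mul, one_mul, mul_add, mul_one, smul_mul_assoc, hT2, smul_zero, add_zero,
          succ_nsmul]
        abel
    have hcardpow : (ρW (k : G)) ^ Nat.card P = 1 := by
      rw [← map_pow, ← Subgroup.coe_pow, pow_card_eq_one', Subgroup.coe_one, map_one]
    rw [hpow] at hcardpow
    have hNT : (Nat.card P : F) • T = 0 := by
      rw [Nat.cast_smul_eq_nsmul]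
      calc Nat.card P • T = (1 + Nat.card P • T) - 1 := by abel
        _ = 0 := by rw [hcardpow]; exact sub_self (1 : Module.End F W)
    have hT0 : T = 0 := (smul_eq_zero.1 hNT).resolve_left hPF
    have hk1 : ρW (k : G) = 1 := by
      rw [← sub_eq_zero, ← hT]
      exact hT0
    -- `k` fixes every translate, hence `k = 1`
    have hfix : ∀ h : G, translateInd Φ (h * (k : G)⁻¹) = translateInd Φ h := by
      intro h
      have hmem : u h ∈ W := Submodule.subset_span ⟨h, rfl⟩
      have h1 : ((ρW (k : G) ⟨u h, hmem⟩ : W) : E → F) = u h := by rw [hk1]; rfl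
      funext x
      have h2 := congrFun h1 x
      rw [hρW] at h2
      change u h ((k : G)⁻¹ • x) = u h x at h2
      simp only [hu, ← mul_smul] at h2
      by_cases hx : (h * (k : G)⁻¹) • x ∈ Φ
      · rw [translateInd_of_mem hx]
        rw [if_pos hx] at h2
        by_cases hx' : h • x ∈ Φ
        · rw [translateInd_of_mem hx']
        · rw [if_neg hx'] at h2; exact absurd h2 one_ne_zero
      · rw [translateInd_of_not_mem hx]
        rw [if_neg hx] at h2
        by_cases hx' : h • x ∈ Φ
        · rw [if_pos hx'] at h2; exact absurd h2.symm one_ne_zero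
        · rw [translateInd_of_not_mem hx']
    have h1 := hfaith (k : G)⁻¹ hfix
    rw [inv_eq_one] at h1
    exact Subtype.ext h1
  -- to matrices through a basis of `W ⧸ U`, of dimension `dim W − 2`
  have hdim : Module.finrank F (W ⧸ U) = Module.finrank F W - 2 := by
    have := Submodule.finrank_quotient_add_finrank U
    omega
  let b := Module.finBasis F (W ⧸ U)
  let e := LinearMap.toMatrixAlgEquiv b
  let Ψ : P →* GL (Fin (Module.finrank F (W ⧸ U))) F :=
    (Units.mapEquiv e.toMulEquiv).toMonoidHom.comp ρQ.toHomUnits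
  have hΨ : Function.Injective Ψ := (Units.mapEquiv e.toMulEquiv).injective.comp hinj
  have hd := Subgroup.card_dvd_of_injective Ψ hΨ
  rwa [hdim] at hd

end SylowQuotient

section Dodson

variable {G : Type*} [Group G] [Fintype G] {E : Type*} [Fintype E] [MulAction G E]

/-- **Dodson's `p`-Sylow bound, Thm. 1.14, in Minkowski's form: `v_p(|G|) ≤ M(rank Φ − 2, p)`** for a CM type `Φ`
(`IsCMTypeWith ρ Φ`) whose translates the finite group `G` permutes faithfully and an odd prime `p` — "`B(n) ≥ L(n) =
max_p (R(p, n) + e_p)`, where `e_p = 2` if `p` is odd … (2) If `K` is a given CM-field of degree `2n`, and `G` is the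
group `Gal(Kᶜ/ℚ)`, then for every primitive CM-type `Φ` on `K`, `Rank(Φ) ≥ L(|G|)`"; here `R(p, ·)` is read through
Minkowski's theorem (§6: a finite subgroup of `GL_d(ℚ)` has `v_p ≤ M(d, p)`), i.e. the statement proved is
`v_p(|G|) ≤ M(rank Φ − 2, p) = [(r−2)/(p−1)] + v_p([(r−2)/(p−1)]!)`.  Proof: §7's embedding of the `p`-Sylow subgroup
`P` (Mathlib `Sylow`) in `GL_{m}(𝔽_q)`, `m ≤ rank − 2`, for a prime `q > |G|` generating `(ℤ/p²)ˣ` (`n_P(x₀) ≠ n_P(ρx₀)`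
modulo `q` since their sum `|P|` is odd), and Serre's count (§6). [cite: Dodson1987, Thm. 1.14 (pp. 55–56)]
[cite: Serre2007BoundsFiniteSubgroups, Lecture I Thm. 1 (i)] -/
theorem IsCMTypeWith.padicValNat_card_le_rank_sub_two_div_add {ρ : G} {Φ : Set E} (hΦ : IsCMTypeWith ρ Φ)
    (hfaith : ∀ g : G, (∀ h : G, translateInd Φ (h * g) = translateInd Φ h) → g = 1)
    {p : ℕ} (hp : p.Prime) (hp2 : p ≠ 2) :
    padicValNat p (Fintype.card G) ≤
      (typeRank G Φ - 2) / (p - 1) + padicValNat p ((typeRank G Φ - 2) / (p - 1)).factorial := by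
  classical
  haveI := Fact.mk hp
  rcases isEmpty_or_nonempty E with hE | ⟨⟨x₀⟩⟩
  · have hG : ∀ g : G, g = 1 := fun g => hfaith g fun h => funext fun x => (hE.false x).elim
    have h1 : Fintype.card G = 1 := Fintype.card_eq_one_iff.2 ⟨1, hG⟩
    rw [h1]
    simp
  obtain ⟨P⟩ : Nonempty (Sylow p G) := inferInstance
  have hPcard : Nat.card (P : Subgroup G) = p ^ (Nat.card G).factorization p := Sylow.card_eq_multiplicity P
  have hvG : padicValNat p (Fintype.card G) = (Nat.card G).factorization p := by
    rw [Nat.card_eq_fintype_card, Nat.factorization_def _ hp]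
  -- a prime `ℓ > max(N, |G|)` generating `(ℤ/p²)ˣ`
  obtain ⟨N, hN⟩ := exists_forall_finrank_span_translates_le_typeRank (G := G) Φ
  obtain ⟨ℓ, hℓN, hℓ, hpℓ, hdiv, hv1⟩ := exists_prime_gt_primitiveRoot (p := p) hp2 (max N (Fintype.card G))
  haveI := Fact.mk hℓ
  have hℓN' : N < ℓ := lt_of_le_of_lt (le_max_left _ _) hℓN
  have hℓG : Fintype.card G < ℓ := lt_of_le_of_lt (le_max_right _ _) hℓN
  have hn := hN ℓ hℓN' hℓ
  have hPle : Nat.card (P : Subgroup G) ≤ Fintype.card G := by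
    rw [← Nat.card_eq_fintype_card]
    exact Nat.le_of_dvd Nat.card_pos (Subgroup.card_subgroup_dvd_card _)
  -- `|P| ≠ 0` in `𝔽_ℓ`
  have hPF : (Nat.card (P : Subgroup G) : ZMod ℓ) ≠ 0 := by
    rw [Ne, ZMod.natCast_eq_zero_iff]
    intro hdvd
    have h2 := Nat.le_of_dvd Nat.card_pos hdvd
    omega
  -- `n_P(x₀) ≠ n_P(ρ x₀)` in `𝔽_ℓ`: their sum is `|P|`, odd, and both are `< ℓ`
  have hnc : ∃ x y : E, (∑ k : (P : Subgroup G), (if (k : G) • x ∈ Φ then (1 : ZMod ℓ) else 0)) ≠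
      ∑ k : (P : Subgroup G), (if (k : G) • y ∈ Φ then (1 : ZMod ℓ) else 0) := by
    refine ⟨x₀, ρ • x₀, fun heq => ?_⟩
    rw [Finset.sum_boole, Finset.sum_boole] at heq
    set a := (Finset.univ.filter fun k : (P : Subgroup G) => (k : G) • x₀ ∈ Φ).card with ha
    set b := (Finset.univ.filter fun k : (P : Subgroup G) => (k : G) • ρ • x₀ ∈ Φ).card with hb
    have hfilt : (Finset.univ.filter fun k : (P : Subgroup G) => (k : G) • ρ • x₀ ∈ Φ) =
        Finset.univ.filter fun k : (P : Subgroup G) => ¬ ((k : G) • x₀ ∈ Φ) := by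
      ext k
      simp only [Finset.mem_filter, Finset.mem_univ, true_and]
      rw [hΦ.comm, hΦ.rho_smul_mem_iff]
    have hab : a + b = Fintype.card (P : Subgroup G) := by
      rw [ha, hb, hfilt]
      exact Finset.card_filter_add_card_filter_not _
    have hodd : Odd (a + b) := by
      rw [hab, ← Nat.card_eq_fintype_card, hPcard]
      exact (hp.odd_of_ne_two hp2).pow
    have hcardP : Fintype.card (P : Subgroup G) < ℓ := by
      rw [← Nat.card_eq_fintype_card]
      omega
    have h1 := (ZMod.natCast_eq_natCast_iff' a b ℓ).1 heq
    rw [Nat.mod_eq_of_lt (by omega), Nat.mod_eq_of_lt (by omega)] at h1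
    rw [h1] at hodd
    exact (Nat.not_even_iff_odd.2 hodd) ⟨b, rfl⟩
  -- §7: `|P|` divides `|GL_m(𝔽_ℓ)|`, `m = dim W_ℓ − 2`
  have hdvd := card_subgroup_dvd_card_GL_sub_two (ZMod ℓ) hΦ hfaith (P : Subgroup G) hPF hnc
  rw [Matrix.card_GL_field, ZMod.card] at hdvd
  set m := Module.finrank (ZMod ℓ) (Submodule.span (ZMod ℓ)
    (Set.range fun g : G => fun x : E => if g • x ∈ Φ then (1 : ZMod ℓ) else 0)) - 2 with hm_def
  have hq : 1 < ℓ := hℓ.one_lt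
  have hprod : (∏ i : Fin m, (ℓ ^ m - ℓ ^ (i : ℕ))) ≠ 0 := by
    refine Finset.prod_ne_zero_iff.2 fun i _ => ?_
    have : ℓ ^ (i : ℕ) < ℓ ^ m := Nat.pow_lt_pow_right hq i.2
    omega
  have hmono : m / (p - 1) ≤ (typeRank G Φ - 2) / (p - 1) := Nat.div_le_div_right (Nat.sub_le_sub_right hn 2)
  calc padicValNat p (Fintype.card G)
      = padicValNat p (Nat.card (P : Subgroup G)) := by rw [hvG, hPcard, padicValNat.prime_pow]
    _ ≤ padicValNat p (∏ i : Fin m, (ℓ ^ m - ℓ ^ (i : ℕ))) := padicValNat_le_of_dvd hprod hdvd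
    _ = m / (p - 1) + padicValNat p (m / (p - 1)).factorial := padicValNat_prod_pow_sub_pow_eq hp2 hq hpℓ hdiv hv1 m
    _ ≤ (typeRank G Φ - 2) / (p - 1) + padicValNat p ((typeRank G Φ - 2) / (p - 1)).factorial :=
        add_le_add hmono (padicValNat_le_of_dvd (Nat.factorial_ne_zero _) (Nat.factorial_dvd_factorial hmono))

/-- **Dodson's Thm. 1.14 (2) in Minkowski's form, for a primitive type under a faithful transitive action** (`E =
Hom(K, ℂ)` under `G = Gal(Kᶜ/ℚ)`, "for every primitive CM-type `Φ` on `K`, `Rank(Φ) ≥ L(|G|)`"): `v_p(|G|) ≤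
M(rank Φ − 2, p)` for every odd prime `p`. [cite: Dodson1987, Thm. 1.14 (2) (p. 56)]
[cite: Serre2007BoundsFiniteSubgroups, Lecture I Thm. 1 (i)] -/
theorem IsCMTypeWith.padicValNat_card_le_rank_sub_two_div_add_of_isPrimitive [MulAction.IsPretransitive G E]
    [FaithfulSMul G E] {ρ : G} {Φ : Set E} (hΦ : IsCMTypeWith ρ Φ) {φh : E} (hprim : IsPrimitive G Φ φh)
    {p : ℕ} (hp : p.Prime) (hp2 : p ≠ 2) :
    padicValNat p (Fintype.card G) ≤
      (typeRank G Φ - 2) / (p - 1) + padicValNat p ((typeRank G Φ - 2) / (p - 1)).factorial :=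
  hΦ.padicValNat_card_le_rank_sub_two_div_add (fun g hg => eq_one_of_forall_translateInd_mul_eq hprim g hg) hp hp2

/-- **Thm. 1.14 contains Thm. 1.4 (Ribet's `p + 1`)**: if `p ∣ |G|` (`p` odd, `G` permuting the translates of the CM
type `Φ` faithfully) then `p + 1 ≤ rank Φ` — `M(rank − 2, p) ≥ 1` forces `rank − 2 ≥ p − 1` ("bounds on `B(n)` of the
form `p + 1`, for `p` a prime dividing `n`, follow directly from the proof of Ribet's Nondegeneracy Theorem").
[cite: Dodson1987, Thm. 1.4 and Thm. 1.14 (pp. 51, 55–56)] -/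
theorem IsCMTypeWith.add_one_le_typeRank_of_dvd_card {ρ : G} {Φ : Set E} (hΦ : IsCMTypeWith ρ Φ)
    (hfaith : ∀ g : G, (∀ h : G, translateInd Φ (h * g) = translateInd Φ h) → g = 1)
    {p : ℕ} (hp : p.Prime) (hp2 : p ≠ 2) (hdvd : p ∣ Fintype.card G) : p + 1 ≤ typeRank G Φ := by
  haveI := Fact.mk hp
  have hM := hΦ.padicValNat_card_le_rank_sub_two_div_add hfaith hp hp2
  have hv : 1 ≤ padicValNat p (Fintype.card G) :=
    (padicValNat_dvd_iff_le Fintype.card_ne_zero).1 (by rwa [pow_one])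
  obtain ⟨σ, hσ⟩ : ∃ σ, σ = (typeRank G Φ - 2) / (p - 1) := ⟨_, rfl⟩
  rw [← hσ] at hM
  have hσ1 : 1 ≤ σ := by
    by_contra h0
    have h0' : σ = 0 := by omega
    rw [h0', Nat.factorial_zero, padicValNat_one_right, add_zero] at hM
    omega
  have hp1 : 0 < p - 1 := by have := hp.two_le; omega
  have h1 : p - 1 ≤ typeRank G Φ - 2 := by
    rw [hσ] at hσ1
    have := (Nat.le_div_iff_mul_le hp1).1 hσ1
    omega
  have := hp.two_le
  omega

/-- **Thm. 1.14 contains Thm. 1.12 / Cor. 1.13 (`2q` for `q² ∣ n`)**: if `p² ∣ |G|` (`p` odd, `G` permuting the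
translates of the CM type `Φ` faithfully) then `2p ≤ rank Φ` — `M(rank − 2, p) ≥ 2` forces `rank − 2 ≥ 2(p − 1)`.
[cite: Dodson1987, Thm. 1.12, Cor. 1.13 and Thm. 1.14 (pp. 54–56)] -/
theorem IsCMTypeWith.two_mul_le_typeRank_of_sq_dvd_card {ρ : G} {Φ : Set E} (hΦ : IsCMTypeWith ρ Φ)
    (hfaith : ∀ g : G, (∀ h : G, translateInd Φ (h * g) = translateInd Φ h) → g = 1)
    {p : ℕ} (hp : p.Prime) (hp2 : p ≠ 2) (hdvd : p ^ 2 ∣ Fintype.card G) : 2 * p ≤ typeRank G Φ := by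
  haveI := Fact.mk hp
  have hM := hΦ.padicValNat_card_le_rank_sub_two_div_add hfaith hp hp2
  have hv : 2 ≤ padicValNat p (Fintype.card G) := (padicValNat_dvd_iff_le Fintype.card_ne_zero).1 hdvd
  obtain ⟨σ, hσ⟩ : ∃ σ, σ = (typeRank G Φ - 2) / (p - 1) := ⟨_, rfl⟩
  rw [← hσ] at hM
  have hσ2 : 2 ≤ σ := by
    by_contra h0
    have h01 : σ = 0 ∨ σ = 1 := by omega
    rcases h01 with h0' | h0'
    · rw [h0', Nat.factorial_zero, padicValNat_one_right, add_zero] at hM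
      omega
    · rw [h0', Nat.factorial_one, padicValNat_one_right, add_zero] at hM
      omega
  have hp1 : 0 < p - 1 := by have := hp.two_le; omega
  rw [hσ] at hσ2
  have h1 : 2 * (p - 1) ≤ typeRank G Φ - 2 := (Nat.le_div_iff_mul_le hp1).1 hσ2
  have := hp.two_le
  omega

/-- **Thm. 1.14 sharpens Murty's bound by Dodson's `e_p = 2`**: if `p ∣ |G|` then
`(p − 1)² · v_p(|G|) + (p − 1) ≤ p · (rank Φ − 2)` — from `v_p(|G|) ≤ σ + v_p(σ!)`, `σ = [(rank − 2)/(p − 1)]`, and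
Legendre's `(p − 1) · v_p(σ!) ≤ σ − 1` ("`R(p, n) ≥ e(p − 1)²/p` if `p` is odd").
[cite: Dodson1987, Thm. 1.14 (pp. 55–56)] [cite: Mai1989, §2 Prop. 2] -/
theorem IsCMTypeWith.sq_mul_padicValNat_card_add_le {ρ : G} {Φ : Set E} (hΦ : IsCMTypeWith ρ Φ)
    (hfaith : ∀ g : G, (∀ h : G, translateInd Φ (h * g) = translateInd Φ h) → g = 1)
    {p : ℕ} (hp : p.Prime) (hp2 : p ≠ 2) (hdvd : p ∣ Fintype.card G) :
    (p - 1) ^ 2 * padicValNat p (Fintype.card G) + (p - 1) ≤ p * (typeRank G Φ - 2) := by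
  haveI := Fact.mk hp
  have hM := hΦ.padicValNat_card_le_rank_sub_two_div_add hfaith hp hp2
  have hv : 1 ≤ padicValNat p (Fintype.card G) :=
    (padicValNat_dvd_iff_le Fintype.card_ne_zero).1 (by rwa [pow_one])
  obtain ⟨σ, hσ⟩ : ∃ σ, σ = (typeRank G Φ - 2) / (p - 1) := ⟨_, rfl⟩
  obtain ⟨v, hv_def⟩ : ∃ v, v = padicValNat p (Fintype.card G) := ⟨_, rfl⟩
  obtain ⟨w, hw⟩ : ∃ w, w = padicValNat p σ.factorial := ⟨_, rfl⟩
  obtain ⟨a, ha⟩ : ∃ a, a = p - 1 := ⟨_, rfl⟩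
  obtain ⟨d, hd⟩ : ∃ d, d = typeRank G Φ - 2 := ⟨_, rfl⟩
  rw [← hσ, ← hv_def, ← hw] at hM
  rw [← hv_def] at hv
  have hσ1 : σ ≠ 0 := by
    intro h0'
    rw [h0', Nat.factorial_zero, padicValNat_one_right] at hw
    omega
  have hleg : a * w < σ := by
    rw [ha, hw]
    exact sub_one_mul_padicValNat_factorial_lt_of_ne_zero p hσ1
  have h3 : a * σ ≤ d := by
    rw [hσ, ha, hd, mul_comm]
    exact Nat.div_mul_le_self _ _
  have hpa : p = a + 1 := by have := hp.two_le; omega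
  rw [← hv_def, ← ha, ← hd, hpa]
  have e1 : a * v ≤ a * (σ + w) := Nat.mul_le_mul_left a hM
  have e2 : a * (a * w + 1) ≤ a * σ := Nat.mul_le_mul_left a hleg
  have e3 : (a + 1) * (a * σ) ≤ (a + 1) * d := Nat.mul_le_mul_left (a + 1) h3
  nlinarith [e1, e2, e3]

end Dodson

section DodsonSmallExponent

variable {G : Type*} [Group G] [Fintype G] {E : Type*} [Fintype E] [MulAction G E]

/-- **Thm. 1.14 evaluated for `p^e ∣ |G|`, `e < p`: `e(p − 1) + 2 ≤ rank Φ`** — for `e < p` one has `M(d, p) ≥ e` iff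
`d ≥ e(p − 1)` (the factorial term `v_p([d/(p−1)]!)` vanishes while `[d/(p−1)] < p`), so Dodson's bound reads
`rank ≥ R(p, p^e) + 2 = e(p − 1) + 2`; `e = 1, 2` are Thms. 1.4 and 1.12 / Cor. 1.13 ("`B(n) = 2p` when `n = p²`").
[cite: Dodson1987, Thm. 1.14 and Cor. 1.13 (pp. 55–56)] [cite: Serre2007BoundsFiniteSubgroups, Lecture I Thm. 1] -/
theorem IsCMTypeWith.mul_sub_one_add_two_le_typeRank_of_pow_dvd_card {ρ : G} {Φ : Set E} (hΦ : IsCMTypeWith ρ Φ)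
    (hfaith : ∀ g : G, (∀ h : G, translateInd Φ (h * g) = translateInd Φ h) → g = 1)
    {p : ℕ} (hp : p.Prime) (hp2 : p ≠ 2) {e : ℕ} (he : 1 ≤ e) (hep : e < p) (hdvd : p ^ e ∣ Fintype.card G) :
    e * (p - 1) + 2 ≤ typeRank G Φ := by
  haveI := Fact.mk hp
  have hM := hΦ.padicValNat_card_le_rank_sub_two_div_add hfaith hp hp2
  have hv : e ≤ padicValNat p (Fintype.card G) := (padicValNat_dvd_iff_le Fintype.card_ne_zero).1 hdvd
  obtain ⟨σ, hσ⟩ : ∃ σ, σ = (typeRank G Φ - 2) / (p - 1) := ⟨_, rfl⟩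
  rw [← hσ] at hM
  have hσe : e ≤ σ := by
    by_contra hlt
    push Not at hlt
    have hσp : σ < p := lt_trans hlt hep
    have h0 : padicValNat p σ.factorial = 0 :=
      padicValNat.eq_zero_of_not_dvd fun h => absurd (hp.dvd_factorial.1 h) (not_le.2 hσp)
    rw [h0, add_zero] at hM
    omega
  have hp1 : 0 < p - 1 := by have := hp.two_le; omega
  rw [hσ] at hσe
  have h1 : e * (p - 1) ≤ typeRank G Φ - 2 := (Nat.le_div_iff_mul_le hp1).1 hσe
  have h2 : 1 * (p - 1) ≤ e * (p - 1) := Nat.mul_le_mul_right _ he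
  have := hp.two_le
  omega

end DodsonSmallExponent

/-! ### §8 Through the tree's Minkowski theorem: all primes, and Dodson's `e_p` (`e_2 = 1`, `e_p = 2` for `p` odd)

Found after v2: the tree already proves Minkowski's theorem in full — Serre's Thm. 1 (i) for EVERY prime `ℓ` and every
finite subgroup of `GL_n(ℚ)`, by Schur's trace proof — as
`Literature.GroupTheory.ArithmeticGroups.factorization_card_le_minkowskiExponent` (with
`minkowskiExponent n ℓ = Σ_k [n/((ℓ−1)ℓ^k)] = [n/(ℓ−1)] + v_ℓ([n/(ℓ−1)]!)`,
`minkowskiExponent_eq_add_padicValNat_factorial`).  §6 above is Minkowski's own road (§1.3.3, reduction modulo a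
well-chosen prime) for the groups of this file and `p` odd; this section takes the other road: the faithful
RATIONAL representation `G ↪ GL(W) ≅ GL_r(ℚ)`, `r = rank Φ` (`exists_injective_monoidHom_GL_span_translates`, the
construction of §3 over any field), gives `v_p(|G|) ≤ M(rank Φ, p)` for ALL primes `p`
(`padicValNat_card_le_minkowskiExponent_typeRank`), and Dodson's splitting of `P`-fixed vectors
(`exists_injective_monoidHom_GL_sub_of_fixed`: a subgroup `P` with `|P| ≠ 0` in `F` fixing `k` independent vectors of
`W_F` embeds in `GL_{dim W_F − k}(F)`) gives **Thm. 1.14 for every prime: `v_p(|G|) ≤ M(rank Φ − e_p, p)`,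
`e_p = 2` for `p` odd (`𝟙` and `N_P(𝟙_Φ)`), `e_2 = 1` (`𝟙` alone: "`e_p = 1` if `p` is even")**
(`IsCMTypeWith.padicValNat_card_le_minkowskiExponent_typeRank_sub`). -/

section ViaMinkowski

open Literature.GroupTheory

variable {G : Type*} [Group G] [Fintype G] {E : Type*} [Fintype E] [MulAction G E]

omit [Fintype G] in
open scoped Classical in
/-- **The faithful representation on `W_F`** (§3 over an arbitrary field `F`): if `G` permutes the translates of `Φ`
faithfully then `G ↪ GL(W_F) ≅ GL_n(F)`, `n = dim_F W_F`, `W_F` the `F`-span of the `0/1`-vectors of the translates —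
Mai's "`τ : G → GL(Y)` is an injective group homomorphism", Dodson's "faithful linear representation defined over
the rationals". [cite: Mai1989, §2 Prop. 2 (proof)] [cite: Dodson1987, Thm. 1.14 (proof, p. 56)] -/
theorem exists_injective_monoidHom_GL_span_translates (F : Type*) [Field F] (Φ : Set E)
    (hfaith : ∀ g : G, (∀ h : G, translateInd Φ (h * g) = translateInd Φ h) → g = 1) :
    ∃ Ψ : G →* GL (Fin (Module.finrank F (Submodule.span F
      (Set.range fun g : G => fun x : E => if g • x ∈ Φ then (1 : F) else 0)))) F, Function.Injective Ψ := by
  set u : G → E → F := fun g x => if g • x ∈ Φ then (1 : F) else 0 with hu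
  set W : Submodule F (E → F) := Submodule.span F (Set.range u) with hW
  have hM : ∀ g h : G, LinearMap.funLeft F F (fun x : E => g⁻¹ • x) (u h) = u (h * g⁻¹) := by
    intro g h
    funext x
    simp only [LinearMap.funLeft_apply, hu, mul_smul]
  have hstab : ∀ g : G, ∀ v ∈ W, LinearMap.funLeft F F (fun x : E => g⁻¹ • x) v ∈ W := by
    intro g v hv
    have hle : W.map (LinearMap.funLeft F F (fun x : E => g⁻¹ • x)) ≤ W := by
      rw [hW, Submodule.map_span_le]
      rintro _ ⟨h, rfl⟩
      rw [hM]
      exact Submodule.subset_span ⟨h * g⁻¹, rfl⟩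
    exact hle (Submodule.mem_map_of_mem hv)
  let ρ : G →* Module.End F W :=
    { toFun := fun g => (LinearMap.funLeft F F (fun x : E => g⁻¹ • x)).restrict (hstab g)
      map_one' := by
        apply LinearMap.ext
        intro v
        apply Subtype.ext
        funext x
        simp [LinearMap.restrict_apply]
      map_mul' := fun g g' => by
        apply LinearMap.ext
        intro v
        apply Subtype.ext
        funext x
        simp [LinearMap.restrict_apply, mul_smul] }
  have hρ : ∀ (g : G) (v : W) (x : E), ((ρ g v : W) : E → F) x = (v : E → F) (g⁻¹ • x) := fun g v x => rfl
  have hinj : Function.Injective ρ.toHomUnits := by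
    rw [injective_iff_map_eq_one]
    intro g hg
    have hg' : ρ g = 1 := by
      have := congrArg (fun z : (Module.End F W)ˣ => (z : Module.End F W)) hg
      simpa using this
    have hfix : ∀ h : G, translateInd Φ (h * g⁻¹) = translateInd Φ h := by
      intro h
      have hmem : u h ∈ W := Submodule.subset_span ⟨h, rfl⟩
      have h1 : ((ρ g ⟨u h, hmem⟩ : W) : E → F) = u h := by rw [hg']; rfl
      funext x
      have h2 := congrFun h1 x
      rw [hρ] at h2
      change u h (g⁻¹ • x) = u h x at h2
      simp only [hu, ← mul_smul] at h2
      by_cases hx : (h * g⁻¹) • x ∈ Φ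
      · rw [translateInd_of_mem hx]
        rw [if_pos hx] at h2
        by_cases hx' : h • x ∈ Φ
        · rw [translateInd_of_mem hx']
        · rw [if_neg hx'] at h2; exact absurd h2 one_ne_zero
      · rw [translateInd_of_not_mem hx]
        rw [if_neg hx] at h2
        by_cases hx' : h • x ∈ Φ
        · rw [if_pos hx'] at h2; exact absurd h2.symm one_ne_zero
        · rw [translateInd_of_not_mem hx']
    have := hfaith g⁻¹ hfix
    exact inv_eq_one.1 this
  let b := Module.finBasis F W
  let e := LinearMap.toMatrixAlgEquiv b
  exact ⟨(Units.mapEquiv e.toMulEquiv).toMonoidHom.comp ρ.toHomUnits,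
    (Units.mapEquiv e.toMulEquiv).injective.comp hinj⟩

omit [Fintype G] [Fintype E] in
open scoped Classical in
/-- `W_ℚ` is Dodson's module: its dimension is the rank. [cite: Dodson1987, §1.1 (p. 50)] -/
private theorem finrank_span_rat_eq_typeRank (Φ : Set E) :
    Module.finrank ℚ (Submodule.span ℚ (Set.range fun g : G => fun x : E => if g • x ∈ Φ then (1 : ℚ) else 0)) =
      typeRank G Φ := by
  have hu : (fun g : G => fun x : E => if g • x ∈ Φ then (1 : ℚ) else 0) = translateInd Φ := by
    funext g x
    by_cases hx : g • x ∈ Φ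
    · rw [if_pos hx, translateInd_of_mem hx]
    · rw [if_neg hx, translateInd_of_not_mem hx]
  rw [hu]
  rfl

/-- **Minkowski's theorem (Serre Thm. 1 (i), every prime) for the groups of §5**, through the tree's
`ArithmeticGroups.factorization_card_le_minkowskiExponent`: if `G` permutes the translates of `Φ` faithfully then
`v_p(|G|) ≤ M(rank Φ, p)` for EVERY prime `p` (`p = 2` included). [cite: Serre2007BoundsFiniteSubgroups, Lecture I Thm. 1 (i)]
[cite: Dodson1987, Thm. 1.14 (p. 56)] -/
theorem padicValNat_card_le_minkowskiExponent_typeRank (Φ : Set E)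
    (hfaith : ∀ g : G, (∀ h : G, translateInd Φ (h * g) = translateInd Φ h) → g = 1) {p : ℕ} (hp : p.Prime) :
    padicValNat p (Fintype.card G) ≤ ArithmeticGroups.minkowskiExponent (typeRank G Φ) p := by
  classical
  obtain ⟨Ψ, hΨ⟩ := exists_injective_monoidHom_GL_span_translates (G := G) ℚ Φ hfaith
  have h := ArithmeticGroups.factorization_card_le_minkowskiExponent Ψ.range hp
  rw [Fintype.card_fin, Nat.card_congr (MonoidHom.ofInjective hΨ).toEquiv.symm, Nat.card_eq_fintype_card,
    Nat.factorization_def _ hp] at h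
  exact h.trans (le_of_eq (by rw [finrank_span_rat_eq_typeRank]))

omit [Fintype G] in
open scoped Classical in
/-- **Dodson's splitting, over any field**: if a subgroup `P ≤ G` (with `|P| ≠ 0` in `F`) fixes `k` linearly independent
vectors of `W_F` (as functions: `v_i(g⁻¹x) = v_i(x)` for `g ∈ P`), then `P ↪ GL(W_F/⟨v_1,…,v_k⟩) ≅ GL_{n−k}(F)`,
`n = dim_F W_F` — "we may split off a 1-dimensional trivial representation corresponding to `Φ + Φ̄`" (and, for `p`
odd, the norm `N_P(Φ)`): an element of `P` trivial on the quotient is `1 + T` with `T² = 0` on `W_F`, and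
`(1 + T)^{|P|} = 1 + |P|·T = 1` forces `T = 0`. [cite: Dodson1987, Thm. 1.14 (proof, pp. 55–56)] -/
theorem exists_injective_monoidHom_GL_sub_of_fixed (F : Type*) [Field F] (Φ : Set E)
    (hfaith : ∀ g : G, (∀ h : G, translateInd Φ (h * g) = translateInd Φ h) → g = 1)
    (P : Subgroup G) (hPF : (Nat.card P : F) ≠ 0) {k : ℕ} (v : Fin k → E → F)
    (hvW : ∀ i, v i ∈ Submodule.span F (Set.range fun g : G => fun x : E => if g • x ∈ Φ then (1 : F) else 0))
    (hli : LinearIndependent F v) (hfix : ∀ g ∈ P, ∀ i x, v i (g⁻¹ • x) = v i x) :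
    ∃ m : ℕ, m = Module.finrank F (Submodule.span F
      (Set.range fun g : G => fun x : E => if g • x ∈ Φ then (1 : F) else 0)) - k ∧
      ∃ Ψ : P →* GL (Fin m) F, Function.Injective Ψ := by
  set u : G → E → F := fun g x => if g • x ∈ Φ then (1 : F) else 0 with hu
  set W : Submodule F (E → F) := Submodule.span F (Set.range u) with hW
  have hM : ∀ g h : G, LinearMap.funLeft F F (fun x : E => g⁻¹ • x) (u h) = u (h * g⁻¹) := by
    intro g h
    funext x
    simp only [LinearMap.funLeft_apply, hu, mul_smul]
  have hstab : ∀ g : G, ∀ w ∈ W, LinearMap.funLeft F F (fun x : E => g⁻¹ • x) w ∈ W := by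
    intro g w hw
    have hle : W.map (LinearMap.funLeft F F (fun x : E => g⁻¹ • x)) ≤ W := by
      rw [hW, Submodule.map_span_le]
      rintro _ ⟨h, rfl⟩
      rw [hM]
      exact Submodule.subset_span ⟨h * g⁻¹, rfl⟩
    exact hle (Submodule.mem_map_of_mem hw)
  let ρW : G →* Module.End F W :=
    { toFun := fun g => (LinearMap.funLeft F F (fun x : E => g⁻¹ • x)).restrict (hstab g)
      map_one' := by
        apply LinearMap.ext
        intro w
        apply Subtype.ext
        funext x
        simp [LinearMap.restrict_apply]
      map_mul' := fun g g' => by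
        apply LinearMap.ext
        intro w
        apply Subtype.ext
        funext x
        simp [LinearMap.restrict_apply, mul_smul] }
  have hρW : ∀ (g : G) (w : W) (x : E), ((ρW g w : W) : E → F) x = (w : E → F) (g⁻¹ • x) := fun g w x => rfl
  -- the fixed vectors inside `W` and their span `U`
  set v' : Fin k → W := fun i => ⟨v i, hvW i⟩ with hv'
  have hfix' : ∀ (g : P) (i : Fin k), ρW (g : G) (v' i) = v' i := by
    intro g i
    apply Subtype.ext
    funext x
    rw [hρW]
    exact hfix (g : G) g.2 i x
  set U : Submodule F W := Submodule.span F (Set.range v') with hU_def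
  have hli' : LinearIndependent F v' := by
    refine LinearIndependent.of_comp W.subtype ?_
    exact hli
  have hUk : Module.finrank F U = k := by
    rw [hU_def, finrank_span_eq_card hli', Fintype.card_fin]
  have hUle : ∀ g : P, U ≤ U.comap (ρW (g : G)) := by
    intro g
    rw [hU_def, Submodule.span_le]
    rintro _ ⟨i, rfl⟩
    rw [SetLike.mem_coe, Submodule.mem_comap, hfix' g i]
    exact Submodule.subset_span ⟨i, rfl⟩
  let ρQ : P →* Module.End F (W ⧸ U) :=
    { toFun := fun g => U.mapQ U (ρW (g : G)) (hUle g)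
      map_one' := by
        apply Submodule.linearMap_qext
        apply LinearMap.ext
        intro w
        simp [Submodule.mapQ_apply]
      map_mul' := fun g g' => by
        apply Submodule.linearMap_qext
        apply LinearMap.ext
        intro w
        simp [Submodule.mapQ_apply, Module.End.mul_apply] }
  have hinj : Function.Injective ρQ.toHomUnits := by
    rw [injective_iff_map_eq_one]
    intro g hg
    have hg' : ρQ g = 1 := by
      have := congrArg (fun z : (Module.End F (W ⧸ U))ˣ => (z : Module.End F (W ⧸ U))) hg
      simpa using this
    set T : Module.End F W := ρW (g : G) - 1 with hT
    have hTU : ∀ w : W, T w ∈ U := by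
      intro w
      have h1 : U.mkQ (ρW (g : G) w) = U.mkQ w := by
        have h2 := LinearMap.congr_fun hg' (U.mkQ w)
        rw [Module.End.one_apply] at h2
        rw [← h2]
        rfl
      rw [hT, LinearMap.sub_apply, Module.End.one_apply, ← Submodule.Quotient.eq, ← Submodule.mkQ_apply,
        ← Submodule.mkQ_apply]
      exact h1
    have hTU0 : ∀ w ∈ U, T w = 0 := by
      intro w hw
      rw [hU_def] at hw
      refine Submodule.span_induction ?_ ?_ ?_ ?_ hw
      · rintro _ ⟨i, rfl⟩
        rw [hT, LinearMap.sub_apply, Module.End.one_apply, hfix' g i, sub_self]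
      · exact map_zero T
      · intro a b _ _ ha hb
        rw [map_add, ha, hb, add_zero]
      · intro c a _ ha
        rw [map_smul, ha, smul_zero]
    have hT2 : T * T = 0 := by
      apply LinearMap.ext
      intro w
      rw [Module.End.mul_apply, LinearMap.zero_apply]
      exact hTU0 _ (hTU w)
    have hpow : ∀ N : ℕ, (ρW (g : G)) ^ N = 1 + N • T := by
      intro N
      have hk1 : ρW (g : G) = 1 + T := by rw [hT]; abel
      induction N with
      | zero => rw [pow_zero, zero_smul, add_zero]
      | succ N ih =>
        rw [pow_succ, ih, hk1, add_mul, one_mul, mul_add, mul_one, smul_mul_assoc, hT2, smul_zero, add_zero,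
          succ_nsmul]
        abel
    have hcardpow : (ρW (g : G)) ^ Nat.card P = 1 := by
      rw [← map_pow, ← Subgroup.coe_pow, pow_card_eq_one', Subgroup.coe_one, map_one]
    rw [hpow] at hcardpow
    have hNT : (Nat.card P : F) • T = 0 := by
      rw [Nat.cast_smul_eq_nsmul]
      calc Nat.card P • T = (1 + Nat.card P • T) - 1 := by abel
        _ = 0 := by rw [hcardpow]; exact sub_self (1 : Module.End F W)
    have hT0 : T = 0 := (smul_eq_zero.1 hNT).resolve_left hPF
    have hk1 : ρW (g : G) = 1 := by
      rw [← sub_eq_zero, ← hT]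
      exact hT0
    have hfixall : ∀ h : G, translateInd Φ (h * (g : G)⁻¹) = translateInd Φ h := by
      intro h
      have hmem : u h ∈ W := Submodule.subset_span ⟨h, rfl⟩
      have h1 : ((ρW (g : G) ⟨u h, hmem⟩ : W) : E → F) = u h := by rw [hk1]; rfl
      funext x
      have h2 := congrFun h1 x
      rw [hρW] at h2
      change u h ((g : G)⁻¹ • x) = u h x at h2
      simp only [hu, ← mul_smul] at h2
      by_cases hx : (h * (g : G)⁻¹) • x ∈ Φ
      · rw [translateInd_of_mem hx]
        rw [if_pos hx] at h2
        by_cases hx' : h • x ∈ Φ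
        · rw [translateInd_of_mem hx']
        · rw [if_neg hx'] at h2; exact absurd h2 one_ne_zero
      · rw [translateInd_of_not_mem hx]
        rw [if_neg hx] at h2
        by_cases hx' : h • x ∈ Φ
        · rw [if_pos hx'] at h2; exact absurd h2.symm one_ne_zero
        · rw [translateInd_of_not_mem hx']
    have h1 := hfaith (g : G)⁻¹ hfixall
    rw [inv_eq_one] at h1
    exact Subtype.ext h1
  have hdim : Module.finrank F (W ⧸ U) = Module.finrank F W - k := by
    have := Submodule.finrank_quotient_add_finrank U
    omega
  let b := Module.finBasis F (W ⧸ U)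
  let e := LinearMap.toMatrixAlgEquiv b
  exact ⟨Module.finrank F (W ⧸ U), hdim, (Units.mapEquiv e.toMulEquiv).toMonoidHom.comp ρQ.toHomUnits,
    (Units.mapEquiv e.toMulEquiv).injective.comp hinj⟩

open scoped Classical in
/-- **Dodson's Theorem 1.14 for EVERY prime, through Minkowski's theorem: `v_p(|G|) ≤ M(rank Φ − e_p, p)` with
`e_p = 2` for `p` odd and `e_2 = 1`** ("`B(n) ≥ L(n) = max_p (R(p, n) + e_p)`, where `e_p = 2` if `p` is odd, `e_p = 1`
if `p` is even … the value of `e_p` for `p` odd follows from the independence of the norm `N_P(Φ) = Σ_{g∈P} Φᵍ` from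
`Φ + Φ̄`, which depends upon `p` being odd"): the `p`-Sylow subgroup `P` of `G` fixes `𝟙 = Φ + Φ̄` (and, for `p` odd,
the independent `n_P = N_P(𝟙_Φ)`: `n_P(x) + n_P(ρx) = |P|` is odd), so `P ↪ GL_{r − e_p}(ℚ)`
(`exists_injective_monoidHom_GL_sub_of_fixed`) and Minkowski's theorem (the tree's
`ArithmeticGroups.factorization_card_le_minkowskiExponent`) bounds `v_p(|P|) = v_p(|G|)`.
[cite: Dodson1987, Thm. 1.14 (pp. 55–56)] [cite: Serre2007BoundsFiniteSubgroups, Lecture I Thm. 1 (i)] -/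
theorem IsCMTypeWith.padicValNat_card_le_minkowskiExponent_typeRank_sub {ρ : G} {Φ : Set E}
    (hΦ : IsCMTypeWith ρ Φ) (hfaith : ∀ g : G, (∀ h : G, translateInd Φ (h * g) = translateInd Φ h) → g = 1)
    {p : ℕ} (hp : p.Prime) :
    padicValNat p (Fintype.card G) ≤
      ArithmeticGroups.minkowskiExponent (typeRank G Φ - if p = 2 then 1 else 2) p := by
  haveI := Fact.mk hp
  rcases isEmpty_or_nonempty E with hE | ⟨⟨x₀⟩⟩
  · have hG : ∀ g : G, g = 1 := fun g => hfaith g fun h => funext fun x => (hE.false x).elim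
    have h1 : Fintype.card G = 1 := Fintype.card_eq_one_iff.2 ⟨1, hG⟩
    rw [h1]
    simp
  obtain ⟨P⟩ : Nonempty (Sylow p G) := inferInstance
  have hPcard : Nat.card (P : Subgroup G) = p ^ (Nat.card G).factorization p := Sylow.card_eq_multiplicity P
  have hvG : padicValNat p (Fintype.card G) = (Nat.card G).factorization p := by
    rw [Nat.card_eq_fintype_card, Nat.factorization_def _ hp]
  have hPF : (Nat.card (P : Subgroup G) : ℚ) ≠ 0 := Nat.cast_ne_zero.2 Nat.card_pos.ne'
  set u : G → E → ℚ := fun g x => if g • x ∈ Φ then (1 : ℚ) else 0 with hu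
  set W : Submodule ℚ (E → ℚ) := Submodule.span ℚ (Set.range u) with hW
  have hWr : Module.finrank ℚ W = typeRank G Φ := finrank_span_rat_eq_typeRank (G := G) Φ
  -- `𝟙 = u 1 + u ρ ∈ W`, fixed by everybody
  have hone_mem : (fun _ : E => (1 : ℚ)) ∈ W := by
    have h1 : (fun _ : E => (1 : ℚ)) = u 1 + u ρ := by
      funext x
      simp only [hu, Pi.add_apply, one_smul]
      by_cases hx : x ∈ Φ
      · rw [if_pos hx, if_neg (fun h => (hΦ.rho_smul_mem_iff x).1 h hx), add_zero]
      · rw [if_neg hx, if_pos ((hΦ.rho_smul_mem_iff x).2 hx), zero_add]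
    rw [h1]
    exact W.add_mem (Submodule.subset_span ⟨1, rfl⟩) (Submodule.subset_span ⟨ρ, rfl⟩)
  have hone_ne : (fun _ : E => (1 : ℚ)) ≠ 0 := fun h => one_ne_zero (congrFun h x₀)
  -- `n_P = Σ_{k ∈ P} u k ∈ W`, fixed by `P`
  set nP : E → ℚ := ∑ k : (P : Subgroup G), u (k : G) with hnP
  have hnP_apply : ∀ x : E, nP x = ((Finset.univ.filter fun k : (P : Subgroup G) => (k : G) • x ∈ Φ).card : ℚ) := by
    intro x
    rw [hnP, Finset.sum_apply]
    simp only [hu]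
    rw [Finset.sum_boole]
  have hnP_mem : nP ∈ W := W.sum_mem fun k _ => Submodule.subset_span ⟨(k : G), rfl⟩
  have hnP_fix : ∀ g ∈ (P : Subgroup G), ∀ x : E, nP (g⁻¹ • x) = nP x := by
    intro g hg x
    rw [hnP, Finset.sum_apply, Finset.sum_apply]
    refine Finset.sum_equiv (Equiv.mulRight (⟨g, hg⟩⁻¹ : (P : Subgroup G))) (fun _ => by simp) fun k' _ => ?_
    simp only [hu, Equiv.coe_mulRight, Subgroup.coe_mul, Subgroup.coe_inv, mul_smul]
  have hconclude : ∀ {k : ℕ} (v : Fin k → E → ℚ), (∀ i, v i ∈ W) → LinearIndependent ℚ v →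
      (∀ g ∈ (P : Subgroup G), ∀ i x, v i (g⁻¹ • x) = v i x) →
      padicValNat p (Fintype.card G) ≤ ArithmeticGroups.minkowskiExponent (typeRank G Φ - k) p := by
    intro k v hvW hli hfix
    obtain ⟨m, hm, Ψ, hΨ⟩ :=
      exists_injective_monoidHom_GL_sub_of_fixed (G := G) ℚ Φ hfaith (P : Subgroup G) hPF v hvW hli hfix
    have h := ArithmeticGroups.factorization_card_le_minkowskiExponent Ψ.range hp
    rw [Fintype.card_fin, Nat.card_congr (MonoidHom.ofInjective hΨ).toEquiv.symm, hPcard,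
      Nat.factorization_def _ hp, padicValNat.prime_pow] at h
    rw [hvG]
    exact h.trans (le_of_eq (by rw [hm, hWr]))
  by_cases hp2 : p = 2
  · -- `e_2 = 1`: split off `𝟙`
    rw [if_pos hp2]
    refine hconclude ![fun _ : E => (1 : ℚ)] (fun i => ?_) ?_ (fun g _ i x => ?_)
    · fin_cases i
      exact hone_mem
    · exact linearIndependent_unique_iff.2 hone_ne
    · fin_cases i
      rfl
  · -- `e_p = 2`: split off `𝟙` and `n_P`, independent because `n_P(x₀) + n_P(ρx₀) = |P|` is odd
    rw [if_neg hp2]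
    have hnc : nP x₀ ≠ nP (ρ • x₀) := by
      intro heq
      rw [hnP_apply, hnP_apply, Nat.cast_inj] at heq
      set a := (Finset.univ.filter fun k : (P : Subgroup G) => (k : G) • x₀ ∈ Φ).card with ha
      set b := (Finset.univ.filter fun k : (P : Subgroup G) => (k : G) • ρ • x₀ ∈ Φ).card with hb
      have hfilt : (Finset.univ.filter fun k : (P : Subgroup G) => (k : G) • ρ • x₀ ∈ Φ) =
          Finset.univ.filter fun k : (P : Subgroup G) => ¬ ((k : G) • x₀ ∈ Φ) := by
        ext k
        simp only [Finset.mem_filter, Finset.mem_univ, true_and]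
        rw [hΦ.comm, hΦ.rho_smul_mem_iff]
      have hab : a + b = Fintype.card (P : Subgroup G) := by
        rw [ha, hb, hfilt]
        exact Finset.card_filter_add_card_filter_not _
      have hodd : Odd (a + b) := by
        rw [hab, ← Nat.card_eq_fintype_card, hPcard]
        exact (hp.odd_of_ne_two hp2).pow
      rw [heq] at hodd
      exact (Nat.not_even_iff_odd.2 hodd) ⟨b, rfl⟩
    have hli : LinearIndependent ℚ ![(fun _ : E => (1 : ℚ)), nP] := by
      rw [LinearIndependent.pair_iff]
      intro s t hst
      have hx : ∀ x : E, s + t * nP x = 0 := fun x => by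
        have h1 := congrFun hst x
        simpa using h1
      by_cases ht : t = 0
      · refine ⟨?_, ht⟩
        have h1 := hx x₀
        rwa [ht, zero_mul, add_zero] at h1
      · exfalso
        apply hnc
        have h1 := hx x₀
        have h2 := hx (ρ • x₀)
        have h3 : t * (nP x₀ - nP (ρ • x₀)) = 0 := by linear_combination h1 - h2
        rcases mul_eq_zero.1 h3 with h4 | h4
        · exact absurd h4 ht
        · exact sub_eq_zero.1 h4
    refine hconclude ![(fun _ : E => (1 : ℚ)), nP] (fun i => ?_) hli (fun g hg i x => ?_)
    · fin_cases i
      · exact hone_mem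
      · exact hnP_mem
    · fin_cases i
      · rfl
      · exact hnP_fix g hg x

end ViaMinkowski

end Literature.NumberTheory.ComplexMultiplication
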